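import Literature.Computability.AlgebraicComplexity.GKKP11SymmetricRepresentations
import Literature.Computability.AlgebraicComplexity.SymmetricDetRepresentationProofs
import HarnessLib

/-!
# Proof of GKKP 2011, Theorems 4 and 6 and Proposition 1 (discharge of the named facts
`GKKP2011_thm4`, `GKKP2011_thm6`, `GKKP2011_prop1`)

Discharge (D-0014) of `Literature.Computability.AlgebraicComplexity.GKKP2011_thm4`
(`GKKP11SymmetricRepresentations.lean`) — the V1 dictionary entry "weakly-skew circuit of fat
size `m` ⇒ symmetric affine pencil of size `2m+1`": B. Grenet, E. L. Kaltofen, P. Koiran,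
N. Portier, *Symmetric determinantal representation of formulas and weakly skew circuits*,
Contemp. Math. 556 (2011) 61–96 = arXiv:1007.3804, §3.1, **Theorem 4** with **Lemma 4** (read
as the held text `paper:arxiv-1007.3804`, p0011–p0013): "Let `f` be a polynomial computable by
a weakly-skew circuit of fat size `m`. Then there exists a symmetric matrix `A` of dimensions at
most `2m+1` whose entries are inputs of the circuit and elements from `{0,1,-1,1/2}` such that
`f = det A`" (typed with the extra entry `2` of the addition gate `β + β`, see the fact's
docstring), for CLASSICAL weakly-skew circuits in the model `GKKP2011.Circuit` (gate list in
topological order, `IsWeaklySkew`, `IsClassical`).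

## The printed proof and how it is followed

**Lemma 4** (graph of a multiple-output weakly-skew circuit `C` of fat size `m`): a graph `G`
with `≤ 2m+1` vertices and a distinguished `s`, `|G|` odd, all cycles even, `G ∖ {s}` with a
unique cycle cover (a perfect matching of weight `1`), and for every REUSABLE gate `α` a vertex
`t_α` with the acceptable-path identity (3) `Σ_{acceptable s–t_α paths P} (-1)^{(|P|-1)/2} w(P)
= f_α`. Induction on `m`, removing an output `α`: input `x` ↦ two new vertices `v_α, t_α`, edges
`s v_α` (`x`), `v_α t_α` (`-1`); addition `β + γ` ↦ `v_α, t_α` with `t_β v_α`, `t_γ v_α` (`1`;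
one edge of weight `2` if `β = γ`) and `v_α t_α` (`-1`); multiplication `β × γ` with `β` the
closed (non-reusable) argument ↦ `C ∖ {α} = C₁ ⊔ C₂` (`C₁` = the closed sub-circuit of `β`), `G`
= `G₂ ∪ G₁` with `s₁` MERGED into `t_γ`, `s = s₂`, `t_α = t_β`. **Theorem 4**: add to `G` the
edge `s t` of weight `½ (-1)^{(|G|-1)/2}`; cycle covers of `G'` ↔ `s`–`t` paths (both
directions), whence `det A(G') = f`.

*Rendering (same graph, algebraic bookkeeping — as in the tree's proofs of Thms. 5, 7, 2, 3).*
The vertices of `G ∖ {s}` come in matched pairs `(v_α, t_α)`; index the pairs by a finite type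
`V` and let `X : Matrix V V` carry the links on the diagonal (weight `-1`) and the edges
`t_β — v_α` off the diagonal, `a : V → R` the edges at `s`. The adjacency matrix of `G'` is the
block matrix on `s ⊕ (in ⊕ out)` of `Thm4.det_layout`, whose determinant is
`(-1)^{|V|+1} · 2 · ((a X⁻¹) · h)` by the Schur complement of the middle block (`h` = the
`s`–`out` edges, here the single edge `s t` of weight `½`); GKKP's identity (3) is the statement
`-(a X⁻¹)_{t_α} = f_α` (the expansion `X⁻¹ = -(Σ_i N^i)`-type sums run over the acceptable
paths; with all links `-1` the signs `(-1)^{(|P|-1)/2}` cancel against the links).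
**`Thm4.exists_graph`** is Lemma 4 in this form, proved by the printed induction, phrased on
ARGUMENT-CLOSED SETS `T` of gate indices of the ambient circuit (= its multiple-output weakly-skew
sub-circuits; removing the top gate `α = max T`): the three gadgets are `Thm4.prePair` (input /
addition: `Thm4.newPair_*`; multiplication: the split `T ∖ {α} = T₁ ⊔ T₂` by membership in the
closed sub-circuit of `β` — both parts argument-closed by `IsClosedArg` — and the gluing
`Thm4.glue_*` of the two graphs given by the induction hypothesis, `s₁ ↦ t_γ`). "Reusable in
`T`" is rendered choice-free as "in no closed multiplicand (`IsClosedArg`) of a multiplication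
gate of `T`"; the printed remarks "`β` and `γ` are reusable", "`γ ∉ C₁`", "`C₁` is closed" are
`Thm4.reusable_of_mem_argsAt`, `Thm4.not_inSubCircuit_other`, `Thm4.not_inSubCircuit_of_mem_argsAt`.
Invariants carried: explicit inverse `G` of `X` (block formulas), `det X = ±1`, `|V| ≤ |T|`
(GKKP: `|G| ≤ 2m+1`; multiplication gates cost no pair), entries inputs of `C` or `0, ±1, 2`.

**Theorem 4** = `GKKP2011_thm4_holds`: the graph of `T = {0, …, m-2}` plus the output gate's
pair, then the layout with the edge `s t_out` of weight `½`. ONE DEVIATION, forced by the typed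
entry set: the printed `st`-weight `½ (-1)^{(|G|-1)/2}` may be `-½`, which is not in the stated
set `{0, 1, -1, ½}` (nor in the fact's); we keep the entry `+½` and instead give the OUTPUT pair
the link weight `(-1)^{|V|}` (`±1`, allowed), which flips the same sign (`Thm4.newPair_vecMul`
with a general link `d`, `d² = 1`). Dimension: `2(|V|+1) + 1 ≤ 2m + 1`. The cycle-cover
arguments of the print (parity, unique matchings) are replaced by the block-determinant algebra;
the gate semantics of the list model (`Circuit.gateValues`) is unfolded in
`Thm4.getD_gateValues` / `Thm4.getD_gateValues_take`.

**Proposition 1** (§5.1, p0019–p0020: in characteristic `2`, `p²` is a symmetric determinant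
of size `2m+2`) = `GKKP2011_prop1_holds`. Printed proof: Malod–Portier's matrix `M` of size
`m+1` with `per M = det M = p` and its bipartite double `[[0, M], [Mᵀ, 0]]`. Here the matrix
`M` is read off the SAME graph (Lemma 4 for the whole circuit): by Cramer's rule, replacing the
row of the output pair in `X` by the source edges `a` gives a matrix of size `|V| ≤ m` with
determinant `det X · (a X⁻¹)_t = ∓ p` (`Thm4.det_updateRow_eq`) — the tree's construction in
place of Malod–Portier's, one size smaller; then the bipartite double has determinant `p²` in
characteristic `2`, and an identity block pads it to size exactly `2m+2` (`HasSymmDetRepr` is a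
fixed-size predicate).

**Theorem 6** (§3.3, p0014–p0015: a MINIMIZED weighted weakly-skew circuit with `e`
computation gates and `i` variable inputs ⇒ symmetric matrix of dimension `≤ 2(e+i)+1`, entries
inputs or constants) = `GKKP2011_thm6_holds`, via `Thm4.exists_weighted_graph` = the printed
adaptation of Lemma 4 ("for every reusable gate `α` there exists a constant `c_α` such that
`c_α · Σ_{acceptable s–t_α paths} (-1)^{(|P|-1)/2} w(P) = f_α`", eq. (5)): the same induction with
weights on the edges — addition gate with a constant argument `β` (an input labelled `1` by
minimization, arrow weight `c₁`): edge `s v_α` of weight `c₁` and `t_γ v_α` of weight `c₂c_γ`, no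
pair for `β`; addition of non-constant arguments: `t_β v_α`, `t_γ v_α` of weights `c₁c_β`,
`c₂c_γ` (one edge of the summed weight when `t_β = t_γ`, covering the printed `2c₁c_β`);
multiplication: gluing as in Lemma 4 with `c_α = c₁c₂c_βc_γ` ("no available edge to put the
constants"); variable input: a pair as in Lemma 4 — so the pairs are indexed by addition gates and
variable inputs only, `|V| ≤ e + i` (`Thm4.card_pairGates_le`); finally the edge `s t` carries
"the constant associated to the output gate" times `½` (we also fold the sign `(-1)^{|V|}` into
this constant: entries may be arbitrary constants of `k` here), `Thm4.det_layout` again, dimension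
`2|V| + 1 ≤ 2(e+i) + 1`; a circuit whose output is a constant input `c` gets the `1 × 1` matrix
`(c)`. Minimization (Lemma 5 (i)–(iii), `IsMinimized`) is used exactly where the print uses it:
constant arguments of additions are inputs labelled `1`, multiplication arguments are non-constant.

**Tree-vocabulary corollaries** (section `Corollaries`): `Thm4.hasDetRepr_fatSize` /
`Thm4.determinantalComplexity_le_fatSize` (an affine determinantal representation of size exactly
the fat size, hence `dc(f) ≤ m`, for classical weakly-skew circuits over any field — the Cramer
matrix of the graph; cf. Malod–Portier's `m+1`), and the unconditional forms of the three
discharged facts for `sdc`: `Thm4.symmDeterminantalComplexity_le_of_isWeaklySkew` (`≤ 2m+1`),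
`Thm4.symmDeterminantalComplexity_le_of_isMinimized` (`≤ 2(e+i)+1`),
`Thm4.symmDeterminantalComplexity_sq_le_of_charTwo` (`≤ 2m+2` for `p²` in characteristic `2`).

No new definitions, no new named facts (D-0026): theorems only. Honest framing: bookkeeping for
rung V1 of the `ValiantsHypothesis` ladder (the symmetric-pencil dictionary of
`Theses/LacunarySymmetroid`, `Theses/SymPencil`); `VP ≠ VNP` is NOT proved and nothing here is
progress on it.

## References

* [GrenetEtAl2011] B. Grenet, E. L. Kaltofen, P. Koiran, N. Portier, Contemp. Math. 556 (2011)
  61–96 = arXiv:1007.3804, §3.1 Thm. 4, Lemma 4 and their proofs (held text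
  `paper:arxiv-1007.3804`, p0011–p0013); §3.3 Thm. 6 and its proof (p0014–p0015); §5.1 Prop. 1
  and its proof (p0019–p0020); §3.2 Thm. 5 (proof) for the symmetrisation blocks
  (`SymmetricDetRepresentationProofs.lean`).
* [MalodPortier2008] G. Malod, N. Portier, J. Complexity 24 (2008) (weakly-skew circuits).
-/

noncomputable section

namespace Literature.Computability.AlgebraicComplexity

open MvPolynomial Matrix Finset

namespace GKKP2011

namespace Thm4

/-! ## Part I. Algebra of the graph gadgets -/

section NewPair

variable {V : Type*} [Fintype V] [DecidableEq V] {R : Type*} [CommRing R]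

/-- **New matched pair** (GKKP Lemma 4, input and addition steps: "adding two new vertices
`v_α` and `t_α` … and an edge of weight `-1` between `v_α` and `t_α`"; here with a general link
weight `d`, `d² = 1`): the explicit inverse. The new pair receives the edges `c` from the old
`out`-vertices and the edge `x₀` from `s`. [cite: GrenetEtAl2011, Lemma 4 (proof)] -/
private theorem newPair_mul_inv (X G : Matrix V V R) (hXG : X * G = 1) (c : V → R) (d : R)
    (hd : d * d = 1) :
    Matrix.fromBlocks X (Matrix.of fun v (_ : Unit) => c v) 0 (Matrix.of fun (_ _ : Unit) => d) *
      Matrix.fromBlocks G (Matrix.of fun v (_ : Unit) => -(d * (G *ᵥ c) v)) 0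
        (Matrix.of fun (_ _ : Unit) => d) = 1 := by
  have hE : X * (Matrix.of fun v (_ : Unit) => -(d * (G *ᵥ c) v)) +
      (Matrix.of fun v (_ : Unit) => c v) * (Matrix.of fun (_ _ : Unit) => d) = 0 := by
    have hXGc : X *ᵥ (G *ᵥ c) = c := by rw [mulVec_mulVec, hXG, one_mulVec]
    ext v u
    have h1 : ∑ x, X v x * (G *ᵥ c) x = c v := by
      have := congrFun hXGc v
      simpa [mulVec, dotProduct] using this
    have h2 : ∑ x, X v x * (d * (G *ᵥ c) x) = d * c v := by
      rw [← h1, Finset.mul_sum]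
      exact Finset.sum_congr rfl fun x _ => by ring
    simp [Matrix.mul_apply, h2, mul_comm]
  have hD : (Matrix.of fun (_ _ : Unit) => d) * (Matrix.of fun (_ _ : Unit) => d) =
      (1 : Matrix Unit Unit R) := by
    ext u u'
    simp [Matrix.mul_apply, hd]
  rw [fromBlocks_multiply, hXG, hE, hD]
  simp

/-- New matched pair: `det X' = det X · d`. [cite: GrenetEtAl2011, Lemma 4 (proof)] -/
private theorem newPair_det (X : Matrix V V R) (c : V → R) (d : R) :
    (Matrix.fromBlocks X (Matrix.of fun v (_ : Unit) => c v) 0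
      (Matrix.of fun (_ _ : Unit) => d)).det = X.det * d := by
  rw [det_fromBlocks_zero₂₁, Matrix.det_unique (Matrix.of fun (_ _ : Unit) => d)]
  simp

omit [DecidableEq V] in
/-- New matched pair: the path sums `a X⁻¹` at the old pairs are unchanged, and at the new pair
equal `d · (x₀ - (a X⁻¹) · c)`. [cite: GrenetEtAl2011, Lemma 4 (proof)] -/
private theorem newPair_vecMul (G : Matrix V V R) (a c : V → R) (x₀ d : R) :
    Sum.elim a (fun _ => x₀) ᵥ*
      Matrix.fromBlocks G (Matrix.of fun v (_ : Unit) => -(d * (G *ᵥ c) v)) 0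
        (Matrix.of fun (_ _ : Unit) => d) =
      Sum.elim (a ᵥ* G) (fun _ => d * (x₀ - (a ᵥ* G) ⬝ᵥ c)) := by
  rw [vecMul_fromBlocks, Sum.elim_comp_inl, Sum.elim_comp_inr, vecMul_zero, add_zero]
  congr 1
  ext u
  have h1 : (a ᵥ* Matrix.of (fun v (_ : Unit) => -(d * (G *ᵥ c) v))) u =
      -(d * ∑ x, a x * (G *ᵥ c) x) := by
    simp only [vecMul, dotProduct, Matrix.of_apply]
    rw [Finset.mul_sum, ← Finset.sum_neg_distrib]
    exact Finset.sum_congr rfl fun x _ => by ring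
  have h2 : ((fun _ : Unit => x₀) ᵥ* Matrix.of (fun (_ _ : Unit) => d)) u = x₀ * d := by
    simp [vecMul, dotProduct]
  have h3 : (a ᵥ* G) ⬝ᵥ c = ∑ x, a x * (G *ᵥ c) x := (dotProduct_mulVec a G c).symm
  rw [Pi.add_apply, h1, h2, h3]
  ring

omit [DecidableEq V] in
/-- One new matched pair. [cite: GrenetEtAl2011, Lemma 4 (proof)] -/
private theorem card_newPair : Fintype.card (V ⊕ Unit) = Fintype.card V + 1 := by
  simp

end NewPair

section Glue

variable {V₁ V₂ : Type*} [Fintype V₁] [DecidableEq V₁] [Fintype V₂] [DecidableEq V₂]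
  {R : Type*} [CommRing R]

/-- **Gluing** (GKKP Lemma 4, multiplication step: "the union of `G₁` and `G₂` where `t_γ` and
`s₁` are merged" — the source edges `a₁` of the closed sub-circuit's graph now leave the
`out`-vertex `w = t_γ`): the explicit inverse of the block upper-triangular matrix.
[cite: GrenetEtAl2011, Lemma 4 (proof)] -/
private theorem glue_mul_inv (X₂ G₂ : Matrix V₂ V₂ R) (h₂ : X₂ * G₂ = 1) (X₁ G₁ : Matrix V₁ V₁ R)
    (h₁ : X₁ * G₁ = 1) (w : V₂) (a₁ : V₁ → R) :
    Matrix.fromBlocks X₂ (Matrix.of fun u v => if u = w then a₁ v else 0) 0 X₁ *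
      Matrix.fromBlocks G₂ (-(G₂ * (Matrix.of fun u v => if u = w then a₁ v else 0) * G₁)) 0 G₁ =
      1 := by
  rw [fromBlocks_multiply, h₂, h₁]
  have hE : X₂ * -(G₂ * (Matrix.of fun u v => if u = w then a₁ v else 0) * G₁) +
      (Matrix.of fun u v => if u = w then a₁ v else 0) * G₁ = 0 := by
    rw [Matrix.mul_neg, ← Matrix.mul_assoc, ← Matrix.mul_assoc, h₂, Matrix.one_mul, neg_add_cancel]
  rw [hE]
  simp

/-- Gluing: `det X = det X₂ · det X₁`. [cite: GrenetEtAl2011, Lemma 4 (proof)] -/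
private theorem glue_det (X₂ : Matrix V₂ V₂ R) (X₁ : Matrix V₁ V₁ R) (w : V₂) (a₁ : V₁ → R) :
    (Matrix.fromBlocks X₂ (Matrix.of fun u v => if u = w then a₁ v else 0) 0 X₁).det =
      X₂.det * X₁.det :=
  det_fromBlocks_zero₂₁ _ _ _

omit [DecidableEq V₁] in
/-- Gluing: the path sums at the pairs of `G₂` are unchanged; at a pair `v` of `G₁` they are
`-(a₂ X₂⁻¹)_w · (a₁ X₁⁻¹)_v` (every path into `G₁` enters through `w`).
[cite: GrenetEtAl2011, Lemma 4 (proof)] -/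
private theorem glue_vecMul (G₂ : Matrix V₂ V₂ R) (G₁ : Matrix V₁ V₁ R) (w : V₂) (a₂ : V₂ → R)
    (a₁ : V₁ → R) :
    Sum.elim a₂ 0 ᵥ*
      Matrix.fromBlocks G₂ (-(G₂ * (Matrix.of fun u v => if u = w then a₁ v else 0) * G₁)) 0 G₁ =
      Sum.elim (a₂ ᵥ* G₂) (fun v => -((a₂ ᵥ* G₂) w * (a₁ ᵥ* G₁) v)) := by
  rw [vecMul_fromBlocks, Sum.elim_comp_inl, Sum.elim_comp_inr, zero_vecMul, add_zero, zero_vecMul,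
    add_zero, vecMul_neg, ← vecMul_vecMul, ← vecMul_vecMul]
  have hE : (a₂ ᵥ* G₂) ᵥ* (Matrix.of fun u v => if u = w then a₁ v else 0) =
      (a₂ ᵥ* G₂) w • a₁ := by
    ext v
    simp [vecMul, dotProduct, Finset.sum_ite_eq']
  rw [hE, Matrix.smul_vecMul]
  congr 1

omit [DecidableEq V₁] [DecidableEq V₂] in
/-- Gluing adds no vertex. [cite: GrenetEtAl2011, Lemma 4 (proof)] -/
private theorem card_glue : Fintype.card (V₂ ⊕ V₁) = Fintype.card V₂ + Fintype.card V₁ :=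
  Fintype.card_sum

end Glue

section Layout

variable {V : Type*} [Fintype V] [DecidableEq V] {R : Type*} [CommRing R]

/-- **GKKP's final graph `G'`** (proof of Thm. 4: "adding an edge between `t` and `s`"), algebraic
form: the adjacency matrix on `s`, the `in`-vertices and the `out`-vertices, with `s`–`in` edges
`a`, `s`–`out` edges `h`, links and inner edges `X`; if `X G = 1` and `det X = ±1` its determinant
is `(-1)^{|V|+1} · 2 · (a X⁻¹ · h)` (Schur complement of the middle block, whose cycle covers are
GKKP's "unique perfect matching"). [cite: GrenetEtAl2011, Thm 4 (proof)] -/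
theorem det_layout (X G : Matrix V V R) (hG : X * G = 1) (hdet : X.det ^ 2 = 1) (a h : V → R) :
    (Matrix.fromBlocks (0 : Matrix Unit Unit R) (Matrix.of fun _ => Sum.elim a h)
      (Matrix.of fun uv (_ : Unit) => Sum.elim a h uv) (Matrix.fromBlocks 0 Xᵀ X 0)).det =
      (-1) ^ (Fintype.card V + 1) * (2 * ((a ᵥ* G) ⬝ᵥ h)) := by
  have hmid : Matrix.fromBlocks 0 Xᵀ X 0 = midBlock (X - 1) := by
    simp [midBlock, transpose_sub, transpose_one]
  have hG' : (1 + (X - 1)) * G = 1 := by rwa [add_sub_cancel]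
  letI : Invertible (midBlock (X - 1)) :=
    invertibleOfRightInverse _ _ (midBlock_mul_midInv (X - 1) G hG')
  have hinv : ⅟(midBlock (X - 1)) = midInv G := invOf_eq_right_inv (midBlock_mul_midInv _ G hG')
  have hGX : G * X = 1 := mul_eq_one_comm.1 hG
  have hdetmid : (midBlock (X - 1)).det = (-1) ^ Fintype.card V := by
    have hfac : midBlock (X - 1) =
        Matrix.fromBlocks 1 (-G) 0 1 * Matrix.fromBlocks 1 Xᵀ X 0 := by
      rw [← hmid, fromBlocks_multiply]
      simp [hGX]
    rw [hfac, det_mul, det_fromBlocks_zero₂₁, det_one, one_mul, one_mul, det_fromBlocks_one₁₁,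
      zero_sub, ← neg_mul, det_mul, det_transpose, det_neg, mul_assoc, ← pow_two, hdet, mul_one]
  have hschur : (Matrix.of fun (_ : Unit) => Sum.elim a h) * midInv G *
      (Matrix.of fun uv (_ : Unit) => Sum.elim a h uv) =
      Matrix.of fun (_ _ : Unit) => 2 * ((a ᵥ* G) ⬝ᵥ h) := by
    have hT : (Matrix.of fun uv (_ : Unit) => Sum.elim a h uv) =
        (Matrix.of fun (_ : Unit) => Sum.elim a h)ᵀ := rfl
    rw [hT]
    ext i j
    rw [mul_mul_transpose_apply]
    have hq : ∑ x : V, ∑ y : V, a x * G x y * h y = (a ᵥ* G) ⬝ᵥ h := by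
      simp only [vecMul, dotProduct, Finset.sum_mul]
      rw [Finset.sum_comm]
    have hq' : ∑ x : V, ∑ y : V, h x * G y x * a y = (a ᵥ* G) ⬝ᵥ h := by
      rw [← hq, Finset.sum_comm]
      exact Finset.sum_congr rfl fun x _ => Finset.sum_congr rfl fun y _ => by ring
    simp [midInv, Fintype.sum_sum_type, hq, hq']
    ring
  rw [hmid, det_fromBlocks₂₂, hinv, hdetmid, hschur, Matrix.det_unique]
  simp [pow_succ]

omit [Fintype V] [DecidableEq V] in
/-- The layout matrix is symmetric. [cite: GrenetEtAl2011, Thm 4 (proof)] -/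
theorem isSymm_layout (X : Matrix V V R) (a h : V → R) :
    (Matrix.fromBlocks (0 : Matrix Unit Unit R) (Matrix.of fun _ => Sum.elim a h)
      (Matrix.of fun uv (_ : Unit) => Sum.elim a h uv) (Matrix.fromBlocks 0 Xᵀ X 0)).IsSymm := by
  refine Matrix.IsSymm.fromBlocks (by simp) rfl ?_
  exact Matrix.IsSymm.fromBlocks (by simp) (transpose_transpose X) (by simp)

omit [DecidableEq V] in
/-- The layout has `2|V| + 1` vertices (`|G|` odd, as in Lemma 4). [cite: GrenetEtAl2011, Lemma 4] -/
theorem card_layout : Fintype.card (Unit ⊕ (V ⊕ V)) = 2 * Fintype.card V + 1 := by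
  simp only [Fintype.card_sum, Fintype.card_unit]
  ring

end Layout

/-! ## Part II. The circuit model: gate values, sub-circuits, closed arguments -/

section CircuitFacts

variable {k : Type*} [CommSemiring k] {σ : Type*}

/-- Evaluating a longer gate list extends the list of values. [cite: GrenetEtAl2011, Def 1] -/
private theorem gateValues_append (l₁ l₂ : List (Node k σ)) :
    ∃ r, Circuit.gateValues (l₁ ++ l₂) = Circuit.gateValues l₁ ++ r ∧ r.length = l₂.length := by
  induction l₂ using List.reverseRecOn with
  | nil => exact ⟨[], by simp, rfl⟩
  | append_singleton l₂ g ih =>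
    obtain ⟨r, hr, hlen⟩ := ih
    refine ⟨r ++ [g.eval (Circuit.gateValues (l₁ ++ l₂))], ?_, by simp [hlen]⟩
    rw [← List.append_assoc, Circuit.gateValues_append_singleton, hr, List.append_assoc]

/-- The values of a prefix of the gate list are a prefix of the values. [cite: GrenetEtAl2011, Def 1] -/
private theorem gateValues_take (gs : List (Node k σ)) (p : ℕ) :
    (Circuit.gateValues gs).take p = Circuit.gateValues (gs.take p) := by
  obtain ⟨r, hr, hlen⟩ := gateValues_append (gs.take p) (gs.drop p)
  rw [List.take_append_drop] at hr
  rw [hr]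
  by_cases hp : p ≤ gs.length
  · exact List.take_left' (by rw [Circuit.length_gateValues, List.length_take]; omega)
  · have hdrop : gs.drop p = [] := List.drop_eq_nil_of_le (by omega)
    rw [hdrop] at hlen
    have hr0 : r = [] := List.eq_nil_of_length_eq_zero hlen
    rw [hr0, List.append_nil, List.take_of_length_le]
    rw [Circuit.length_gateValues, List.length_take]
    omega

/-- The value of gate number `p` is its evaluation against the values of the earlier gates
(Def. 1: the circuit is evaluated along the topological order). [cite: GrenetEtAl2011, Def 1] -/
private theorem getD_gateValues (gs : List (Node k σ)) (p : ℕ) (g : Node k σ)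
    (hg : gs[p]? = some g) :
    (Circuit.gateValues gs).getD p 0 = g.eval (Circuit.gateValues (gs.take p)) := by
  obtain ⟨hp, hpg⟩ := List.getElem?_eq_some_iff.1 hg
  have hsplit : gs = (gs.take p ++ [g]) ++ gs.drop (p + 1) := by
    rw [List.append_assoc, List.singleton_append, ← hpg, ← List.drop_eq_getElem_cons hp,
      List.take_append_drop]
  obtain ⟨r, hr, -⟩ := gateValues_append (gs.take p ++ [g]) (gs.drop (p + 1))
  rw [← hsplit, Circuit.gateValues_append_singleton] at hr
  have hlen : (Circuit.gateValues (gs.take p)).length = p := by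
    rw [Circuit.length_gateValues, List.length_take]
    omega
  rw [List.getD_eq_getElem?_getD, hr, List.append_assoc, List.getElem?_append_right (by omega),
    hlen, Nat.sub_self]
  simp

/-- Earlier values seen from gate `p` are the final values. [cite: GrenetEtAl2011, Def 1] -/
private theorem getD_gateValues_take (gs : List (Node k σ)) {i p : ℕ} (hi : i < p) :
    (Circuit.gateValues (gs.take p)).getD i 0 = (Circuit.gateValues gs).getD i 0 := by
  rw [← gateValues_take, List.getD_eq_getElem?_getD, List.getD_eq_getElem?_getD,
    List.getElem?_take, if_pos hi]

end CircuitFacts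

section CircuitShape

variable {k : Type*} {σ : Type*} (C : Circuit k σ)

/-- The arguments of a listed gate. [cite: GrenetEtAl2011, Def 1] -/
private theorem argsAt_eq {p : ℕ} {g : Node k σ} (hg : C.gates[p]? = some g) :
    C.argsAt p = g.args := by
  unfold Circuit.argsAt
  rw [hg]

/-- In a well-formed circuit arguments come earlier. [cite: GrenetEtAl2011, Def 1] -/
private theorem lt_of_mem_argsAt (hwf : C.WellFormed) {q p : ℕ} (h : q ∈ C.argsAt p) : q < p := by
  unfold Circuit.argsAt at h
  cases hg : C.gates[p]? with
  | none => rw [hg] at h; simp at h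
  | some g => rw [hg] at h; exact hwf p g hg q h

/-- A gate with arguments is a listed gate. [cite: GrenetEtAl2011, Def 1] -/
private theorem lt_fatSize_of_mem_argsAt {q p : ℕ} (h : q ∈ C.argsAt p) : p < C.fatSize := by
  unfold Circuit.argsAt at h
  cases hg : C.gates[p]? with
  | none => rw [hg] at h; simp at h
  | some g => exact (List.getElem?_eq_some_iff.1 hg).1

/-- Sub-circuits only contain earlier gates. [cite: GrenetEtAl2011, Def 2] -/
private theorem le_of_inSubCircuit (hwf : C.WellFormed) {q p : ℕ} (h : C.InSubCircuit q p) :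
    q ≤ p := by
  induction h with
  | refl => exact le_rfl
  | tail _ hrp ih => exact ih.trans (lt_of_mem_argsAt C hwf hrp).le

/-- The sub-circuit of an argument of `p` lies strictly below `p`. [cite: GrenetEtAl2011, Def 2] -/
private theorem lt_of_inSubCircuit_of_mem_argsAt (hwf : C.WellFormed) {q r p : ℕ}
    (hq : C.InSubCircuit q r) (hr : r ∈ C.argsAt p) : q < p :=
  (le_of_inSubCircuit C hwf hq).trans_lt (lt_of_mem_argsAt C hwf hr)

/-- A set of gates closed under arguments contains the sub-circuits of its members.
[cite: GrenetEtAl2011, Def 2] -/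
private theorem mem_of_inSubCircuit {T : Finset ℕ} (hT : ∀ v ∈ T, ∀ r ∈ C.argsAt v, r ∈ T)
    {q p : ℕ} (h : C.InSubCircuit q p) (hp : p ∈ T) : q ∈ T := by
  induction h with
  | refl => exact hp
  | tail _ hrp ih => exact ih (hT _ hp _ hrp)

/-- Sub-circuits are closed under arguments. [cite: GrenetEtAl2011, Def 2] -/
private theorem inSubCircuit_of_mem_argsAt {q r p : ℕ} (hr : C.InSubCircuit r p)
    (hq : q ∈ C.argsAt r) : C.InSubCircuit q p :=
  Relation.ReflTransGen.head hq hr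

/-- **Closed arguments (Def. 3), first consequence**: no gate outside the closed sub-circuit of
`β` other than `α` takes an argument inside it. [cite: GrenetEtAl2011, Def 3] -/
private theorem not_inSubCircuit_of_mem_argsAt {α β v r : ℕ} (hcl : C.IsClosedArg α β)
    (hv : ¬ C.InSubCircuit v β) (hvα : v ≠ α) (hr : r ∈ C.argsAt v) : ¬ C.InSubCircuit r β := by
  intro hrβ
  have h := hcl v r hv hrβ
  rw [if_neg (fun h' => hvα h'.1)] at h
  exact (List.count_eq_zero.1 h) hr

/-- **Closed arguments, second consequence**: the other argument of `α` is outside the closed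
sub-circuit ("`α` receives arrows from two distinct gates `β` and `γ`", proof of Lemma 4).
[cite: GrenetEtAl2011, Def 3] -/
private theorem not_inSubCircuit_other (hwf : C.WellFormed) {α β o : ℕ} (hcl : C.IsClosedArg α β)
    (hβ : β ∈ C.argsAt α) (ho : o ∈ C.argsAt α) (hcount : o = β → 2 ≤ (C.argsAt α).count β) :
    ¬ C.InSubCircuit o β := by
  intro hoβ
  have hα : ¬ C.InSubCircuit α β := fun h =>
    lt_irrefl α (lt_of_inSubCircuit_of_mem_argsAt C hwf h hβ)
  have h := hcl α o hα hoβ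
  by_cases hob : o = β
  · rw [if_pos ⟨rfl, hob⟩] at h
    have := hcount hob
    rw [hob] at h
    omega
  · rw [if_neg (fun h' => hob h'.2)] at h
    exact (List.count_eq_zero.1 h) ho

/-- Arguments of a gate outside an argument-closed set `S` of gates are REUSABLE in `S`: they lie
in no closed multiplicand of a multiplication gate of `S` (GKKP, proof of Lemma 4: "Note that
`β` and `γ` are reusable"). [cite: GrenetEtAl2011, Lemma 4 (proof)] -/
private theorem reusable_of_mem_argsAt {S : Finset ℕ} (hS : ∀ v ∈ S, ∀ r ∈ C.argsAt v, r ∈ S)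
    {α r : ℕ} (hα : α ∉ S) (hr : r ∈ C.argsAt α) :
    ∀ δ ∈ S, ∀ (c₁ : k) (i : ℕ) (c₂ : k) (j : ℕ), C.gates[δ]? = some (.mul c₁ i c₂ j) →
      ∀ b, (b = i ∨ b = j) → C.IsClosedArg δ b → ¬ C.InSubCircuit r b := by
  intro δ hδ c₁ i c₂ j hδg b hb hclb hrb
  have hbargs : b ∈ C.argsAt δ := by
    rw [argsAt_eq C hδg]
    rcases hb with rfl | rfl <;> simp [Node.args]
  have hbS : b ∈ S := hS δ hδ b hbargs
  have hαb : ¬ C.InSubCircuit α b := fun h => hα (mem_of_inSubCircuit C hS h hbS)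
  have hαδ : α ≠ δ := fun h => hα (h ▸ hδ)
  exact not_inSubCircuit_of_mem_argsAt C hclb hαb hαδ hr hrb

/-- The top gate `b` of a sub-circuit is reusable in (any set of gates inside) that sub-circuit.
[cite: GrenetEtAl2011, Lemma 4 (proof)] -/
private theorem reusable_top (hwf : C.WellFormed) {S : Finset ℕ} {b : ℕ}
    (hS : ∀ q ∈ S, C.InSubCircuit q b) :
    ∀ δ ∈ S, ∀ (c₁ : k) (i : ℕ) (c₂ : k) (j : ℕ), C.gates[δ]? = some (.mul c₁ i c₂ j) →
      ∀ b', (b' = i ∨ b' = j) → C.IsClosedArg δ b' → ¬ C.InSubCircuit b b' := by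
  intro δ hδ c₁ i c₂ j hδg b' hb' _ hbb'
  have h1 : δ ≤ b := le_of_inSubCircuit C hwf (hS δ hδ)
  have hb'args : b' ∈ C.argsAt δ := by
    rw [argsAt_eq C hδg]
    rcases hb' with rfl | rfl <;> simp [Node.args]
  have h2 : b < δ := lt_of_inSubCircuit_of_mem_argsAt C hwf hbb' hb'args
  omega

end CircuitShape

/-! ## Part III. The graph of a multiple-output weakly-skew circuit (GKKP Lemma 4) -/

section Program

variable {k : Type*} [Field k] {σ : Type*} (C : Circuit k σ)

/-- Entries of a block matrix. [folklore] -/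
private theorem forall_fromBlocks {R : Type*} {l m n o : Type*} {P : R → Prop} {A : Matrix n l R}
    {B : Matrix n m R} {C' : Matrix o l R} {D : Matrix o m R} (hA : ∀ i j, P (A i j))
    (hB : ∀ i j, P (B i j)) (hC : ∀ i j, P (C' i j)) (hD : ∀ i j, P (D i j)) :
    ∀ i j, P (Matrix.fromBlocks A B C' D i j) := by
  rintro (i | i) (j | j)
  · simpa using hA i j
  · simpa using hB i j
  · simpa using hC i j
  · simpa using hD i j

/-- Entries of a juxtaposed vector. [folklore] -/
private theorem forall_sumElim {R : Type*} {m n : Type*} {P : R → Prop} {a : m → R} {b : n → R}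
    (ha : ∀ i, P (a i)) (hb : ∀ i, P (b i)) : ∀ i, P (Sum.elim a b i) := by
  rintro (i | i)
  · simpa using ha i
  · simpa using hb i

/-- **GKKP Lemma 4, inductive step: the gadget of one more gate** (before closing the new
matched pair). Given graphs for all smaller argument-closed sets of gates (`ih`), an
argument-closed set `T'` and a gate `α ∉ T'` with arguments in `T'`, there is a graph — pairs
`V`, links/edges `X` with inverse `G` and `det X = ±1`, source edges `a`, all weights inputs of
`C` or in `{0, 1, -1, 2}` — in which every gate of `T'` reusable in `T' ∪ {α}` is computed at
some `out`-vertex (`-(a X⁻¹)_u = f_q`), together with the attachment (`c`, `x₀`) of the new pair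
`v_α t_α`: `x₀ - (a X⁻¹) · c = f_α`. Input gate: `x₀ =` its label (edge `s v_α`); addition gate:
`c = e_{t_β} + e_{t_γ}` (edges `t_β v_α`, `t_γ v_α` of weight `1`, weight `2` if `β = γ`);
multiplication gate: the graph is the GLUING of the graph of the closed sub-circuit of `β` under
`t_γ` with the graph of the remaining gates, and `c = e_{t_β}`. [cite: GrenetEtAl2011, Lemma 4 (proof)] -/
private theorem prePair (hwf : C.WellFormed) (hcl : C.IsClassical)
    (hws : ∀ (a : ℕ) (c₁ : k) (i : ℕ) (c₂ : k) (j : ℕ),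
      C.gates[a]? = some (.mul c₁ i c₂ j) → C.IsClosedArg a i ∨ C.IsClosedArg a j)
    {n : ℕ}
    (ih : ∀ n' < n, ∀ T : Finset ℕ, T.card = n' → (∀ v ∈ T, v < C.fatSize) →
      (∀ v ∈ T, ∀ r ∈ C.argsAt v, r ∈ T) →
      ∃ (V : Type) (_ : Fintype V) (_ : DecidableEq V) (X G : Matrix V V (MvPolynomial σ k))
        (a : V → MvPolynomial σ k),
        Fintype.card V ≤ n' ∧ X * G = 1 ∧ X.det ^ 2 = 1 ∧
        (∀ u v, C.IsInput (X u v) ∨ IsGKKPScalar (X u v) ∨ X u v = 2) ∧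
        (∀ u, C.IsInput (a u) ∨ IsGKKPScalar (a u) ∨ a u = 2) ∧
        ∀ q ∈ T, (∀ δ ∈ T, ∀ (c₁ : k) (i : ℕ) (c₂ : k) (j : ℕ),
          C.gates[δ]? = some (.mul c₁ i c₂ j) → ∀ b, (b = i ∨ b = j) → C.IsClosedArg δ b →
          ¬ C.InSubCircuit q b) → ∃ u, -((a ᵥ* G) u) = (Circuit.gateValues C.gates).getD q 0)
    (T' : Finset ℕ) (hT'n : T'.card < n) (hT'm : ∀ v ∈ T', v < C.fatSize)
    (hT'c : ∀ v ∈ T', ∀ r ∈ C.argsAt v, r ∈ T') {α : ℕ} (hαT : α ∉ T') {g : Node k σ}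
    (hg : C.gates[α]? = some g) (hargs : ∀ r ∈ C.argsAt α, r ∈ T') :
    ∃ (V : Type) (_ : Fintype V) (_ : DecidableEq V) (X G : Matrix V V (MvPolynomial σ k))
      (a c : V → MvPolynomial σ k) (x₀ : MvPolynomial σ k),
      Fintype.card V ≤ T'.card ∧ X * G = 1 ∧ X.det ^ 2 = 1 ∧
      (∀ u v, C.IsInput (X u v) ∨ IsGKKPScalar (X u v) ∨ X u v = 2) ∧
      (∀ u, C.IsInput (a u) ∨ IsGKKPScalar (a u) ∨ a u = 2) ∧
      (∀ v, C.IsInput (c v) ∨ IsGKKPScalar (c v) ∨ c v = 2) ∧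
      (C.IsInput x₀ ∨ IsGKKPScalar x₀ ∨ x₀ = 2) ∧
      (∀ q ∈ T', (∀ δ ∈ insert α T', ∀ (c₁ : k) (i : ℕ) (c₂ : k) (j : ℕ),
          C.gates[δ]? = some (.mul c₁ i c₂ j) → ∀ b, (b = i ∨ b = j) → C.IsClosedArg δ b →
          ¬ C.InSubCircuit q b) → ∃ u, -((a ᵥ* G) u) = (Circuit.gateValues C.gates).getD q 0) ∧
      x₀ - (a ᵥ* G) ⬝ᵥ c = (Circuit.gateValues C.gates).getD α 0 := by
  have ok0 : C.IsInput (0 : MvPolynomial σ k) ∨ IsGKKPScalar (0 : MvPolynomial σ k) ∨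
      (0 : MvPolynomial σ k) = 2 := Or.inr (Or.inl (Or.inl rfl))
  have ok1 : C.IsInput (1 : MvPolynomial σ k) ∨ IsGKKPScalar (1 : MvPolynomial σ k) ∨
      (1 : MvPolynomial σ k) = 2 := Or.inr (Or.inl (Or.inr (Or.inl rfl)))
  have ok2 : C.IsInput (2 : MvPolynomial σ k) ∨ IsGKKPScalar (2 : MvPolynomial σ k) ∨
      (2 : MvPolynomial σ k) = 2 := Or.inr (Or.inr rfl)
  have hgmem : g ∈ C.gates := List.mem_of_getElem? hg
  have hval := getD_gateValues C.gates α g hg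
  cases g with
  | var x =>
    obtain ⟨V, _, _, X, G, a, hcard, hXG, hdet, hX, ha, hold⟩ := ih _ hT'n T' rfl hT'm hT'c
    refine ⟨V, inferInstance, inferInstance, X, G, a, 0, MvPolynomial.X x, hcard, hXG, hdet, hX,
      ha, fun _ => ok0, Or.inl ⟨.var x, hgmem, rfl⟩, fun q hq hreus => hold q hq
        (fun δ hδ => hreus δ (Finset.mem_insert_of_mem hδ)), ?_⟩
    rw [hval, dotProduct_zero, sub_zero]
    rfl
  | const c =>
    obtain ⟨V, _, _, X, G, a, hcard, hXG, hdet, hX, ha, hold⟩ := ih _ hT'n T' rfl hT'm hT'c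
    refine ⟨V, inferInstance, inferInstance, X, G, a, 0, MvPolynomial.C c, hcard, hXG, hdet, hX,
      ha, fun _ => ok0, Or.inl ⟨.const c, hgmem, rfl⟩, fun q hq hreus => hold q hq
        (fun δ hδ => hreus δ (Finset.mem_insert_of_mem hδ)), ?_⟩
    rw [hval, dotProduct_zero, sub_zero]
    rfl
  | add c₁ i c₂ j =>
    obtain ⟨hc₁, hc₂⟩ : c₁ = 1 ∧ c₂ = 1 := hcl _ hgmem
    subst hc₁ hc₂
    obtain ⟨V, _, _, X, G, a, hcard, hXG, hdet, hX, ha, hold⟩ := ih _ hT'n T' rfl hT'm hT'c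
    have hargs' : C.argsAt α = [i, j] := argsAt_eq C hg
    have hi : i ∈ C.argsAt α := by rw [hargs']; simp
    have hj : j ∈ C.argsAt α := by rw [hargs']; simp
    obtain ⟨ui, hui⟩ := hold i (hargs i hi) (reusable_of_mem_argsAt C hT'c hαT hi)
    obtain ⟨uj, huj⟩ := hold j (hargs j hj) (reusable_of_mem_argsAt C hT'c hαT hj)
    refine ⟨V, inferInstance, inferInstance, X, G, a, Pi.single ui 1 + Pi.single uj 1, 0, hcard,
      hXG, hdet, hX, ha, fun v => ?_, ok0, fun q hq hreus => hold q hq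
        (fun δ hδ => hreus δ (Finset.mem_insert_of_mem hδ)), ?_⟩
    · simp only [Pi.add_apply, Pi.single_apply]
      split_ifs
      · rw [one_add_one_eq_two]; exact ok2
      · rw [add_zero]; exact ok1
      · rw [zero_add]; exact ok1
      · rw [add_zero]; exact ok0
    · rw [hval, dotProduct_add, dotProduct_single, dotProduct_single, mul_one, mul_one, zero_sub,
        neg_add, hui, huj]
      simp only [Node.eval, map_one, one_mul]
      rw [getD_gateValues_take _ (lt_of_mem_argsAt C hwf hi),
        getD_gateValues_take _ (lt_of_mem_argsAt C hwf hj)]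
  | mul c₁ i c₂ j =>
    obtain ⟨hc₁, hc₂⟩ : c₁ = 1 ∧ c₂ = 1 := hcl _ hgmem
    subst hc₁ hc₂
    have hargs' : C.argsAt α = [i, j] := argsAt_eq C hg
    -- the closed argument `b` and the other one `o`
    have key : ∀ b o : ℕ, (b = i ∧ o = j ∨ b = j ∧ o = i) → C.IsClosedArg α b →
        ∃ (V : Type) (_ : Fintype V) (_ : DecidableEq V) (X G : Matrix V V (MvPolynomial σ k))
          (a c : V → MvPolynomial σ k) (x₀ : MvPolynomial σ k),
          Fintype.card V ≤ T'.card ∧ X * G = 1 ∧ X.det ^ 2 = 1 ∧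
          (∀ u v, C.IsInput (X u v) ∨ IsGKKPScalar (X u v) ∨ X u v = 2) ∧
          (∀ u, C.IsInput (a u) ∨ IsGKKPScalar (a u) ∨ a u = 2) ∧
          (∀ v, C.IsInput (c v) ∨ IsGKKPScalar (c v) ∨ c v = 2) ∧
          (C.IsInput x₀ ∨ IsGKKPScalar x₀ ∨ x₀ = 2) ∧
          (∀ q ∈ T', (∀ δ ∈ insert α T', ∀ (c₁ : k) (i : ℕ) (c₂ : k) (j : ℕ),
              C.gates[δ]? = some (.mul c₁ i c₂ j) → ∀ b, (b = i ∨ b = j) → C.IsClosedArg δ b →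
              ¬ C.InSubCircuit q b) →
              ∃ u, -((a ᵥ* G) u) = (Circuit.gateValues C.gates).getD q 0) ∧
          x₀ - (a ᵥ* G) ⬝ᵥ c = (Circuit.gateValues C.gates).getD α 0 := by
      intro b o hbo hclb
      classical
      have hb : b ∈ C.argsAt α := by rw [hargs']; rcases hbo with ⟨rfl, -⟩ | ⟨rfl, -⟩ <;> simp
      have ho : o ∈ C.argsAt α := by rw [hargs']; rcases hbo with ⟨-, rfl⟩ | ⟨-, rfl⟩ <;> simp
      have hob : ¬ C.InSubCircuit o b := by
        refine not_inSubCircuit_other C hwf hclb hb ho fun hob => ?_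
        rw [hargs']
        rcases hbo with ⟨rfl, rfl⟩ | ⟨rfl, rfl⟩ <;> subst hob <;> simp
      -- the closed sub-circuit `T₁` of `b` and the rest `T₂`
      set T₁ := T'.filter (fun q => C.InSubCircuit q b) with hT₁
      set T₂ := T'.filter (fun q => ¬ C.InSubCircuit q b) with hT₂
      have hcardT : T₁.card + T₂.card = T'.card := Finset.card_filter_add_card_filter_not _
      have hT₁m : ∀ v ∈ T₁, v < C.fatSize := fun v hv => hT'm v (Finset.mem_filter.1 hv).1
      have hT₂m : ∀ v ∈ T₂, v < C.fatSize := fun v hv => hT'm v (Finset.mem_filter.1 hv).1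
      have hT₁c : ∀ v ∈ T₁, ∀ r ∈ C.argsAt v, r ∈ T₁ := by
        intro v hv r hr
        obtain ⟨hvT, hvb⟩ := Finset.mem_filter.1 hv
        exact Finset.mem_filter.2 ⟨hT'c v hvT r hr, inSubCircuit_of_mem_argsAt C hvb hr⟩
      have hT₂c : ∀ v ∈ T₂, ∀ r ∈ C.argsAt v, r ∈ T₂ := by
        intro v hv r hr
        obtain ⟨hvT, hvb⟩ := Finset.mem_filter.1 hv
        have hvα : v ≠ α := fun h => hαT (h ▸ hvT)
        exact Finset.mem_filter.2
          ⟨hT'c v hvT r hr, not_inSubCircuit_of_mem_argsAt C hclb hvb hvα hr⟩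
      have hbT₁ : b ∈ T₁ := Finset.mem_filter.2 ⟨hargs b hb, Relation.ReflTransGen.refl⟩
      have hoT₂ : o ∈ T₂ := Finset.mem_filter.2 ⟨hargs o ho, hob⟩
      have hαT₂ : α ∉ T₂ := fun h => hαT (Finset.mem_filter.1 h).1
      obtain ⟨V₁, _, _, X₁, G₁, a₁, hcard₁, hXG₁, hdet₁, hX₁, ha₁, hold₁⟩ :=
        ih _ (by omega) T₁ rfl hT₁m hT₁c
      obtain ⟨V₂, _, _, X₂, G₂, a₂, hcard₂, hXG₂, hdet₂, hX₂, ha₂, hold₂⟩ :=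
        ih _ (by omega) T₂ rfl hT₂m hT₂c
      -- `t_b` computes `f_b` in the graph of `T₁`, `t_o` computes `f_o` in the graph of `T₂`
      obtain ⟨ub, hub⟩ := hold₁ b hbT₁
        (reusable_top C hwf fun q hq => (Finset.mem_filter.1 hq).2)
      obtain ⟨uo, huo⟩ := hold₂ o hoT₂ (reusable_of_mem_argsAt C hT₂c hαT₂ ho)
      refine ⟨V₂ ⊕ V₁, inferInstance, inferInstance,
        Matrix.fromBlocks X₂ (Matrix.of fun u v => if u = uo then a₁ v else 0) 0 X₁,
        Matrix.fromBlocks G₂ (-(G₂ * (Matrix.of fun u v => if u = uo then a₁ v else 0) * G₁)) 0 G₁,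
        Sum.elim a₂ 0, Pi.single (Sum.inr ub) 1, 0, ?_, glue_mul_inv X₂ G₂ hXG₂ X₁ G₁ hXG₁ uo a₁,
        ?_, ?_, ?_, ?_, ok0, ?_, ?_⟩
      · rw [card_glue]; omega
      · rw [glue_det, mul_pow, hdet₁, hdet₂, one_mul]
      · refine forall_fromBlocks (P := fun x => C.IsInput x ∨ IsGKKPScalar x ∨ x = 2) hX₂
          (fun u v => ?_) (fun _ _ => ok0) hX₁
        simp only [Matrix.of_apply]
        split_ifs
        · exact ha₁ v
        · exact ok0
      · exact forall_sumElim (P := fun x => C.IsInput x ∨ IsGKKPScalar x ∨ x = 2) ha₂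
          (fun _ => ok0)
      · intro v
        simp only [Pi.single_apply]
        split_ifs
        · exact ok1
        · exact ok0
      · -- gates of `T'` reusable in `T' ∪ {α}` lie in `T₂`; their vertices are untouched
        intro q hq hreus
        have hqb : ¬ C.InSubCircuit q b :=
          hreus α (Finset.mem_insert_self α T') 1 i 1 j hg b
            (by rcases hbo with ⟨h, -⟩ | ⟨h, -⟩ <;> simp [h]) hclb
        have hqT₂ : q ∈ T₂ := Finset.mem_filter.2 ⟨hq, hqb⟩
        obtain ⟨u, hu⟩ := hold₂ q hqT₂ fun δ hδ =>
          hreus δ (Finset.mem_insert_of_mem (Finset.mem_filter.1 hδ).1)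
        refine ⟨Sum.inl u, ?_⟩
        rw [glue_vecMul]
        exact hu
      · rw [glue_vecMul, dotProduct_single, mul_one, Sum.elim_inr, zero_sub, neg_neg, hval]
        have hneg : ∀ x y : MvPolynomial σ k, -x = (Circuit.gateValues C.gates).getD o 0 →
            -y = (Circuit.gateValues C.gates).getD b 0 →
            x * y = (Circuit.gateValues C.gates).getD b 0 *
              (Circuit.gateValues C.gates).getD o 0 := by
          intro x y hx hy
          rw [← hx, ← hy]
          ring
        rw [hneg _ _ huo hub]
        simp only [Node.eval, map_one, one_mul]
        rw [getD_gateValues_take _ (lt_of_mem_argsAt C hwf (hargs' ▸ by simp : i ∈ C.argsAt α)),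
          getD_gateValues_take _ (lt_of_mem_argsAt C hwf (hargs' ▸ by simp : j ∈ C.argsAt α))]
        rcases hbo with ⟨rfl, rfl⟩ | ⟨rfl, rfl⟩
        · rfl
        · exact mul_comm _ _
    rcases hws α 1 i 1 j hg with h | h
    · exact key i j (Or.inl ⟨rfl, rfl⟩) h
    · exact key j i (Or.inr ⟨rfl, rfl⟩) h

/-- **GKKP 2011, Lemma 4 (graph of a multiple-output weakly-skew circuit), algebraic form.** For
every argument-closed set `T` of gates of a classical weakly-skew circuit `C` (a multiple-output
weakly-skew sub-circuit) there is a graph with matched pairs `V`, `|V| ≤ |T|` (GKKP: at most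
`2|T| + 1` vertices with `s`), links of weight `-1` and edge weights inputs of `C` or `0, 1, 2`
(matrix `X`, `det X = ±1`, explicit inverse `G`), source edges `a`, such that every gate `q` of `T`
REUSABLE in `T` (in no closed multiplicand of a multiplication gate of `T`) has a vertex `t_q`
with `-(a X⁻¹)_{t_q} = f_q` — GKKP's identity (3), the acceptable `s`–`t_q` paths being the
terms of the expansion of `X⁻¹`. Induction on `|T|` removing the top gate, as printed.
[cite: GrenetEtAl2011, Lemma 4] -/
theorem exists_graph (hwf : C.WellFormed) (hcl : C.IsClassical)
    (hws : ∀ (a : ℕ) (c₁ : k) (i : ℕ) (c₂ : k) (j : ℕ),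
      C.gates[a]? = some (.mul c₁ i c₂ j) → C.IsClosedArg a i ∨ C.IsClosedArg a j) (n : ℕ) :
    ∀ T : Finset ℕ, T.card = n → (∀ v ∈ T, v < C.fatSize) →
      (∀ v ∈ T, ∀ r ∈ C.argsAt v, r ∈ T) →
      ∃ (V : Type) (_ : Fintype V) (_ : DecidableEq V) (X G : Matrix V V (MvPolynomial σ k))
        (a : V → MvPolynomial σ k),
        Fintype.card V ≤ n ∧ X * G = 1 ∧ X.det ^ 2 = 1 ∧
        (∀ u v, C.IsInput (X u v) ∨ IsGKKPScalar (X u v) ∨ X u v = 2) ∧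
        (∀ u, C.IsInput (a u) ∨ IsGKKPScalar (a u) ∨ a u = 2) ∧
        ∀ q ∈ T, (∀ δ ∈ T, ∀ (c₁ : k) (i : ℕ) (c₂ : k) (j : ℕ),
          C.gates[δ]? = some (.mul c₁ i c₂ j) → ∀ b, (b = i ∨ b = j) → C.IsClosedArg δ b →
          ¬ C.InSubCircuit q b) → ∃ u, -((a ᵥ* G) u) = (Circuit.gateValues C.gates).getD q 0 := by
  induction n using Nat.strong_induction_on with
  | _ n ih =>
  intro T hTn hTm hTc
  have ok0 : C.IsInput (0 : MvPolynomial σ k) ∨ IsGKKPScalar (0 : MvPolynomial σ k) ∨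
      (0 : MvPolynomial σ k) = 2 := Or.inr (Or.inl (Or.inl rfl))
  have okn : C.IsInput (-1 : MvPolynomial σ k) ∨ IsGKKPScalar (-1 : MvPolynomial σ k) ∨
      (-1 : MvPolynomial σ k) = 2 := Or.inr (Or.inl (Or.inr (Or.inr (Or.inl rfl))))
  rcases T.eq_empty_or_nonempty with hT0 | hne
  · subst hT0
    refine ⟨Fin 0, inferInstance, inferInstance, 1, 1, Fin.elim0, by simp, Matrix.one_mul _,
      by simp, fun u => u.elim0, fun u => u.elim0, fun q hq => ?_⟩
    simp at hq
  -- remove the top gate `α` of `T`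
  set α := T.max' hne with hα
  have hαT : α ∈ T := T.max'_mem hne
  set T' := T.erase α with hT'
  have hαT' : α ∉ T' := Finset.notMem_erase α T
  have hT'card : T'.card = n - 1 := by rw [hT', Finset.card_erase_of_mem hαT, hTn]
  have hn : 0 < n := by rw [← hTn]; exact Finset.card_pos.2 hne
  have hins : insert α T' = T := Finset.insert_erase hαT
  have hT'm : ∀ v ∈ T', v < C.fatSize := fun v hv => hTm v (Finset.mem_of_mem_erase hv)
  have hT'c : ∀ v ∈ T', ∀ r ∈ C.argsAt v, r ∈ T' := by
    intro v hv r hr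
    have hrv : r < v := lt_of_mem_argsAt C hwf hr
    have hvα : v ≤ α := T.le_max' v (Finset.mem_of_mem_erase hv)
    exact Finset.mem_erase.2 ⟨by omega, hTc v (Finset.mem_of_mem_erase hv) r hr⟩
  have hargs : ∀ r ∈ C.argsAt α, r ∈ T' := by
    intro r hr
    have hrα : r < α := lt_of_mem_argsAt C hwf hr
    exact Finset.mem_erase.2 ⟨by omega, hTc α hαT r hr⟩
  obtain ⟨g, hg⟩ : ∃ g, C.gates[α]? = some g :=
    ⟨C.gates[α]'(hTm α hαT), List.getElem?_eq_getElem _⟩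
  obtain ⟨V, _, _, X, G, a, c, x₀, hcard, hXG, hdet, hX, ha, hc, hx₀, hold, hnew⟩ :=
    prePair C hwf hcl hws ih T' (by omega) hT'm hT'c hαT' hg hargs
  -- close the new pair with a link of weight `-1`
  refine ⟨V ⊕ Unit, inferInstance, inferInstance,
    Matrix.fromBlocks X (Matrix.of fun v (_ : Unit) => c v) 0 (Matrix.of fun (_ _ : Unit) => -1),
    Matrix.fromBlocks G (Matrix.of fun v (_ : Unit) => -((-1) * (G *ᵥ c) v)) 0
      (Matrix.of fun (_ _ : Unit) => -1),
    Sum.elim a (fun _ => x₀), ?_, newPair_mul_inv X G hXG c (-1) (by ring), ?_, ?_, ?_, ?_⟩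
  · rw [card_newPair]; omega
  · rw [newPair_det, mul_pow, hdet]; ring
  · exact forall_fromBlocks (P := fun x => C.IsInput x ∨ IsGKKPScalar x ∨ x = 2) hX
      (fun v _ => hc v) (fun _ _ => ok0) (fun _ _ => okn)
  · exact forall_sumElim (P := fun x => C.IsInput x ∨ IsGKKPScalar x ∨ x = 2) ha (fun _ => hx₀)
  · intro q hq hreus
    rw [newPair_vecMul]
    by_cases hqα : q = α
    · subst hqα
      refine ⟨Sum.inr (), ?_⟩
      rw [Sum.elim_inr, ← hnew]
      ring
    · have hqT' : q ∈ T' := Finset.mem_erase.2 ⟨hqα, hq⟩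
      obtain ⟨u, hu⟩ := hold q hqT' (by rw [hins]; exact hreus)
      exact ⟨Sum.inl u, by rw [Sum.elim_inl]; exact hu⟩

end Program

end Thm4

end GKKP2011

/-- **Grenet–Kaltofen–Koiran–Portier 2011, Theorem 4** — discharge of the named fact
`GKKP2011_thm4`: over a field with `2 ≠ 0`, a polynomial computed by a classical weakly-skew
circuit of fat size `m` is the determinant of a symmetric matrix of dimension `≤ 2m + 1` whose
entries are inputs of the circuit or in `{0, 1, -1, 1/2, 2}` — the adjacency matrix of GKKP's
graph `G'` (Lemma 4 + the edge `st` of weight `1/2`), its determinant computed by a Schur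
complement instead of by counting cycle covers; the sign `(-1)^{(|G|-1)/2}` of the printed
`st`-weight is moved onto the link of the output pair, so that the entry is `1/2` as in the
statement. [cite: GrenetEtAl2011, Thm 4] -/
theorem GKKP2011_thm4_holds : GKKP2011_thm4 := by
  intro k _ h2 σ C hclass hws
  obtain ⟨⟨hwf, hne, -⟩, hws'⟩ := hws
  -- the output gate `α = m - 1` and the other gates `T' = {0, …, m-2}`
  have hfs : C.fatSize = C.gates.length := rfl
  have hm : 0 < C.fatSize := by rw [hfs]; exact List.length_pos_iff.2 hne
  set m := C.fatSize with hmdef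
  obtain ⟨g, hg⟩ : ∃ g, C.gates[m - 1]? = some g :=
    ⟨C.gates[m - 1]'(by rw [← hfs]; omega), List.getElem?_eq_getElem _⟩
  have hT'c : ∀ v ∈ Finset.range (m - 1), ∀ r ∈ C.argsAt v, r ∈ Finset.range (m - 1) := by
    intro v hv r hr
    have := GKKP2011.Thm4.lt_of_mem_argsAt C hwf hr
    rw [Finset.mem_range] at hv ⊢
    omega
  have hT'm : ∀ v ∈ Finset.range (m - 1), v < C.fatSize := by
    intro v hv
    rw [Finset.mem_range] at hv
    omega
  have hαT : m - 1 ∉ Finset.range (m - 1) := by simp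
  have hargs : ∀ r ∈ C.argsAt (m - 1), r ∈ Finset.range (m - 1) := fun r hr =>
    Finset.mem_range.2 (GKKP2011.Thm4.lt_of_mem_argsAt C hwf hr)
  obtain ⟨V, _, _, X, G, a, c, x₀, hcard, hXG, hdet, hX, ha, hc, hx₀, -, hnew⟩ :=
    GKKP2011.Thm4.prePair C hwf hclass hws'
      (fun n' _ => GKKP2011.Thm4.exists_graph C hwf hclass hws' n') (Finset.range (m - 1))
      (by rw [Finset.card_range]; exact Nat.lt_succ_self _) hT'm hT'c hαT hg hargs
  rw [Finset.card_range] at hcard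
  -- the output pair, with link `d = (-1)^{|V|}` (so that the `st` edge can have weight `+1/2`)
  set d : MvPolynomial σ k := (-1) ^ Fintype.card V with hd
  have hdd : d * d = 1 := by
    rw [hd, ← pow_add, ← two_mul, pow_mul, neg_one_sq, one_pow]
  have okd : C.IsInput d ∨ IsGKKPScalar d ∨ d = 2 := by
    rcases neg_one_pow_eq_or (MvPolynomial σ k) (Fintype.card V) with h | h
    · rw [hd, h]; exact Or.inr (Or.inl (Or.inr (Or.inl rfl)))
    · rw [hd, h]; exact Or.inr (Or.inl (Or.inr (Or.inr (Or.inl rfl))))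
  have ok0 : C.IsInput (0 : MvPolynomial σ k) ∨ IsGKKPScalar (0 : MvPolynomial σ k) ∨
      (0 : MvPolynomial σ k) = 2 := Or.inr (Or.inl (Or.inl rfl))
  have okh : C.IsInput (MvPolynomial.C (2⁻¹ : k) : MvPolynomial σ k) ∨
      IsGKKPScalar (MvPolynomial.C (2⁻¹ : k) : MvPolynomial σ k) ∨
      (MvPolynomial.C (2⁻¹ : k) : MvPolynomial σ k) = 2 :=
    Or.inr (Or.inl (Or.inr (Or.inr (Or.inr rfl))))
  set X' : Matrix (V ⊕ Unit) (V ⊕ Unit) (MvPolynomial σ k) :=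
    Matrix.fromBlocks X (Matrix.of fun v (_ : Unit) => c v) 0 (Matrix.of fun (_ _ : Unit) => d)
    with hX'
  set G' : Matrix (V ⊕ Unit) (V ⊕ Unit) (MvPolynomial σ k) :=
    Matrix.fromBlocks G (Matrix.of fun v (_ : Unit) => -(d * (G *ᵥ c) v)) 0
      (Matrix.of fun (_ _ : Unit) => d) with hG'
  set a' : V ⊕ Unit → MvPolynomial σ k := Sum.elim a (fun _ => x₀) with ha'
  have hXG' : X' * G' = 1 := GKKP2011.Thm4.newPair_mul_inv X G hXG c d hdd
  have hdet' : X'.det ^ 2 = 1 := by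
    rw [hX', GKKP2011.Thm4.newPair_det, mul_pow, hdet, pow_two, hdd, one_mul]
  have hy' : (a' ᵥ* G') (Sum.inr ()) = d * (GKKP2011.Circuit.gateValues C.gates).getD (m - 1) 0 := by
    rw [ha', hG', GKKP2011.Thm4.newPair_vecMul, Sum.elim_inr, hnew]
  -- GKKP's graph `G'`: `s`, the pairs, and the edge `s t_α` of weight `1/2`
  set h : V ⊕ Unit → MvPolynomial σ k := Pi.single (Sum.inr ()) (MvPolynomial.C 2⁻¹) with hh
  set M := Matrix.fromBlocks (0 : Matrix Unit Unit (MvPolynomial σ k))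
    (Matrix.of fun _ => Sum.elim a' h) (Matrix.of fun uv (_ : Unit) => Sum.elim a' h uv)
    (Matrix.fromBlocks 0 X'ᵀ X' 0) with hM
  have hdetM : M.det = C.eval := by
    rw [hM, GKKP2011.Thm4.det_layout X' G' hXG' hdet' a' h, hh, dotProduct_single, hy',
      GKKP2011.Thm4.card_newPair]
    have heval : C.eval = (GKKP2011.Circuit.gateValues C.gates).getD (m - 1) 0 := by
      rw [GKKP2011.Circuit.eval, List.getLastD_eq_getLast?, List.getLast?_eq_getElem?,
        List.getD_eq_getElem?_getD, GKKP2011.Circuit.length_gateValues]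
      rfl
    have hhalf : (2 : MvPolynomial σ k) * MvPolynomial.C (2⁻¹ : k) = 1 := by
      rw [show (2 : MvPolynomial σ k) = MvPolynomial.C 2 from (map_ofNat MvPolynomial.C 2).symm,
        ← MvPolynomial.C_mul, mul_inv_cancel₀ h2, MvPolynomial.C_1]
    have hpow : ((-1 : MvPolynomial σ k)) ^ (Fintype.card V + 1 + 1) = d := by
      rw [hd, pow_add, pow_add, pow_one]
      ring
    rw [heval, hpow]
    linear_combination (2 * MvPolynomial.C (2⁻¹ : k) *
        (GKKP2011.Circuit.gateValues C.gates).getD (m - 1) 0) * hdd +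
      ((GKKP2011.Circuit.gateValues C.gates).getD (m - 1) 0) * hhalf
  have hcardM : Fintype.card (Unit ⊕ ((V ⊕ Unit) ⊕ (V ⊕ Unit))) = 2 * Fintype.card V + 3 := by
    simp only [Fintype.card_sum, Fintype.card_unit]
    ring
  let eqv : Unit ⊕ ((V ⊕ Unit) ⊕ (V ⊕ Unit)) ≃ Fin (2 * Fintype.card V + 3) :=
    Fintype.equivFinOfCardEq hcardM
  let P : MvPolynomial σ k → Prop := fun x => C.IsInput x ∨ IsGKKPScalar x ∨ x = 2
  have hentries : ∀ u v, P (M u v) := by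
    have hX'ok : ∀ u v, P (X' u v) :=
      GKKP2011.Thm4.forall_fromBlocks (P := P) hX (fun v _ => hc v) (fun _ _ => ok0)
        (fun _ _ => okd)
    have ha'ok : ∀ u, P (a' u) :=
      GKKP2011.Thm4.forall_sumElim (P := P) ha (fun _ => hx₀)
    have hhok : ∀ u, P (h u) := by
      intro u
      show C.IsInput (h u) ∨ IsGKKPScalar (h u) ∨ h u = 2
      rw [hh, Pi.single_apply]
      split_ifs
      · exact okh
      · exact ok0
    have hbord : ∀ uv, P (Sum.elim a' h uv) := GKKP2011.Thm4.forall_sumElim (P := P) ha'ok hhok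
    refine GKKP2011.Thm4.forall_fromBlocks (P := P) (fun _ _ => ok0) (fun _ uv => hbord uv)
      (fun uv _ => hbord uv) ?_
    exact GKKP2011.Thm4.forall_fromBlocks (P := P) (fun _ _ => ok0) (fun u v => hX'ok v u) hX'ok
      (fun _ _ => ok0)
  refine ⟨2 * Fintype.card V + 3, by omega, M.submatrix eqv.symm eqv.symm,
    (GKKP2011.Thm4.isSymm_layout X' a' h).submatrix _, fun i j => ?_, ?_⟩
  · rw [Matrix.submatrix_apply]
    exact hentries _ _
  · rw [Matrix.det_submatrix_equiv_self, hdetM]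

/-! ## GKKP Proposition 1 (characteristic 2): `p²` from the same graph -/

namespace GKKP2011

namespace Thm4

section CharTwo

variable {k : Type*} [Field k] {σ : Type*} (C : Circuit k σ)

/-- An allowed weight (input of `C`, `0, ±1, 1/2, 2`) is an affine linear form. [cite: GrenetEtAl2011, §3.1] -/
private theorem totalDegree_le_one_of_ok {p : MvPolynomial σ k}
    (h : C.IsInput p ∨ IsGKKPScalar p ∨ p = 2) : p.totalDegree ≤ 1 := by
  rcases h with h | h | h
  · exact h.totalDegree_le_one
  · exact h.totalDegree_le_one
  · rw [h, show (2 : MvPolynomial σ k) = MvPolynomial.C 2 from (map_ofNat MvPolynomial.C 2).symm,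
      totalDegree_C]
    exact Nat.zero_le _

/-- **Cramer's rule on the graph of Lemma 4**: replacing the row of the output pair `t` of the
link/edge matrix `X` by the source edges `a` gives a (non-symmetric) matrix of affine linear forms
whose determinant is `det X · (a X⁻¹)_t = ∓ f` — a determinant of size at most the fat size,
playing the role of Malod–Portier's matrix `M` ("`per M = p`") in GKKP's proof of Prop. 1.
[cite: GrenetEtAl2011, Prop 1 (proof)] -/
theorem det_updateRow_eq {V : Type*} [Fintype V] [DecidableEq V]
    (X G : Matrix V V (MvPolynomial σ k)) (hG : X * G = 1) (a : V → MvPolynomial σ k) (u : V) :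
    (X.updateRow u a).det = X.det * (a ᵥ* G) u := by
  have hGX : G * X = 1 := mul_eq_one_comm.1 hG
  have h1 : Xᵀ *ᵥ (X.det • (a ᵥ* G)) = Xᵀ.det • a := by
    rw [mulVec_smul, mulVec_transpose, vecMul_vecMul, hGX, vecMul_one, det_transpose]
  have h2 : Xᵀ *ᵥ (Xᵀ.cramer a) = Xᵀ.det • a := Matrix.mulVec_cramer _ _
  have hinj : ∀ v w : V → MvPolynomial σ k, Xᵀ *ᵥ v = Xᵀ *ᵥ w → v = w := by
    intro v w hvw
    have h := congrArg (fun z => Gᵀ *ᵥ z) hvw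
    simp only [mulVec_mulVec, ← transpose_mul, hG, transpose_one, one_mulVec] at h
    exact h
  have hcr : Xᵀ.cramer a = X.det • (a ᵥ* G) := hinj _ _ (by rw [h2, h1])
  rw [← Matrix.cramer_transpose_apply, hcr, Pi.smul_apply, smul_eq_mul]

end CharTwo

end Thm4

end GKKP2011

/-- **Grenet–Kaltofen–Koiran–Portier 2011, Proposition 1** — discharge of the named fact
`GKKP2011_prop1`: in characteristic `2`, for a polynomial `p` with a classical weakly-skew circuit
of fat size `m`, `p²` is the determinant of a symmetric matrix of affine linear forms of size
`2m + 2`. Printed proof (p0019–p0020): a matrix `M` of size `m+1` with `per M = det M = p`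
(Malod–Portier) and its bipartite double `[[0, M], [Mᵀ, 0]]`. Here `M` is the Cramer matrix
`Thm4.det_updateRow_eq` of the graph of Lemma 4 (`Thm4.exists_graph`, size `≤ m`; the tree's
own construction in place of Malod–Portier's), doubled as `[[0, M], [Mᵀ, 0]]` (determinant
`det(M)² = p²` in characteristic `2`) and padded by an identity block to size exactly `2m + 2`.
[cite: GrenetEtAl2011, Prop 1] -/
theorem GKKP2011_prop1_holds : GKKP2011_prop1 := by
  intro k _ _ σ C hclass hws
  obtain ⟨⟨hwf, hne, -⟩, hws'⟩ := hws
  have hfs : C.fatSize = C.gates.length := rfl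
  have hm : 0 < C.fatSize := by rw [hfs]; exact List.length_pos_iff.2 hne
  set m := C.fatSize with hmdef
  -- the graph of the whole circuit
  have hTc : ∀ v ∈ Finset.range m, ∀ r ∈ C.argsAt v, r ∈ Finset.range m := by
    intro v hv r hr
    have := GKKP2011.Thm4.lt_of_mem_argsAt C hwf hr
    rw [Finset.mem_range] at hv ⊢
    omega
  obtain ⟨V, _, _, X, G, a, hcard, hXG, hdet, hX, ha, hval⟩ :=
    GKKP2011.Thm4.exists_graph C hwf hclass hws' m (Finset.range m) (Finset.card_range m)
      (fun v hv => Finset.mem_range.1 hv) hTc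
  -- the output gate is reusable
  obtain ⟨u, hu⟩ := hval (m - 1) (Finset.mem_range.2 (by omega)) (by
    intro δ hδ c₁ i c₂ j hδg b hb _ hsub
    have hbargs : b ∈ C.argsAt δ := by
      rw [GKKP2011.Thm4.argsAt_eq C hδg]
      rcases hb with rfl | rfl <;> simp [GKKP2011.Node.args]
    have h1 := GKKP2011.Thm4.lt_of_inSubCircuit_of_mem_argsAt C hwf hsub hbargs
    have h2 := Finset.mem_range.1 hδ
    omega)
  have heval : C.eval = (GKKP2011.Circuit.gateValues C.gates).getD (m - 1) 0 := by
    rw [GKKP2011.Circuit.eval, List.getLastD_eq_getLast?, List.getLast?_eq_getElem?,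
      List.getD_eq_getElem?_getD, GKKP2011.Circuit.length_gateValues]
    rfl
  -- Cramer: the non-symmetric matrix `K` with `det K = ∓ p`
  set K := X.updateRow u a with hK
  have hdetK : K.det ^ 2 = C.eval ^ 2 := by
    rw [hK, GKKP2011.Thm4.det_updateRow_eq X G hXG a u, mul_pow, hdet, one_mul, heval, ← hu,
      neg_sq]
  have hKaff : ∀ i j, (K i j).totalDegree ≤ 1 := by
    intro i j
    rw [hK]
    by_cases hi : i = u
    · subst hi
      rw [Matrix.updateRow_self]
      exact GKKP2011.Thm4.totalDegree_le_one_of_ok C (ha j)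
    · rw [Matrix.updateRow_ne hi]
      exact GKKP2011.Thm4.totalDegree_le_one_of_ok C (hX i j)
  -- the bipartite double, in characteristic 2
  set S := Matrix.fromBlocks (0 : Matrix V V (MvPolynomial σ k)) K Kᵀ 0 with hS
  have hJ : Matrix.fromBlocks (0 : Matrix V V (MvPolynomial σ k)) (1 : Matrix V V (MvPolynomial σ k))
        (1 : Matrix V V (MvPolynomial σ k)) (0 : Matrix V V (MvPolynomial σ k)) *
      Matrix.fromBlocks (0 : Matrix V V (MvPolynomial σ k)) (1 : Matrix V V (MvPolynomial σ k))
        (1 : Matrix V V (MvPolynomial σ k)) (0 : Matrix V V (MvPolynomial σ k)) = 1 := by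
    rw [fromBlocks_multiply]
    simp
  have hdetJ : (Matrix.fromBlocks (0 : Matrix V V (MvPolynomial σ k)) (1 : Matrix V V (MvPolynomial σ k))
        (1 : Matrix V V (MvPolynomial σ k)) (0 : Matrix V V (MvPolynomial σ k))).det = 1 := by
    have h := congrArg Matrix.det hJ
    rw [det_mul, det_one] at h
    rcases mul_self_eq_one_iff.1 h with h' | h'
    · exact h'
    · rw [h', CharTwo.neg_eq]
  have hdetS : S.det = C.eval ^ 2 := by
    have hfac : S = Matrix.fromBlocks K 0 0 Kᵀ *
        Matrix.fromBlocks (0 : Matrix V V (MvPolynomial σ k)) (1 : Matrix V V (MvPolynomial σ k))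
        (1 : Matrix V V (MvPolynomial σ k)) (0 : Matrix V V (MvPolynomial σ k)) := by
      rw [hS, fromBlocks_multiply]
      simp
    rw [hfac, det_mul, det_fromBlocks_zero₂₁, det_transpose, hdetJ, mul_one, ← pow_two, hdetK]
  have hSsymm : S.IsSymm := Matrix.IsSymm.fromBlocks (by simp) rfl (by simp)
  have hSaff : ∀ i j, (S i j).totalDegree ≤ 1 := by
    rintro (i | i) (j | j)
    · simp [hS]
    · simpa [hS] using hKaff i j
    · simpa [hS] using hKaff j i
    · simp [hS]
  -- padding by an identity block to size exactly `2m + 2`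
  obtain ⟨r, hr⟩ : ∃ r, Fintype.card V + Fintype.card V + r = 2 * m + 2 :=
    ⟨2 * m + 2 - 2 * Fintype.card V, by omega⟩
  set P := Matrix.fromBlocks S 0 0 (1 : Matrix (Fin r) (Fin r) (MvPolynomial σ k)) with hP
  have hdetP : P.det = C.eval ^ 2 := by
    rw [hP, det_fromBlocks_zero₂₁, det_one, mul_one, hdetS]
  have hPsymm : P.IsSymm := Matrix.IsSymm.fromBlocks hSsymm (by simp) Matrix.isSymm_one
  have hPaff : ∀ i j, (P i j).totalDegree ≤ 1 := by
    rintro (i | i) (j | j)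
    · simpa [hP] using hSaff i j
    · simp [hP]
    · simp [hP]
    · simp only [hP, Matrix.fromBlocks_apply₂₂, Matrix.one_apply]
      split_ifs <;> simp
  have hcardP : Fintype.card ((V ⊕ V) ⊕ Fin r) = 2 * m + 2 := by
    simp only [Fintype.card_sum, Fintype.card_fin]
    omega
  let eqv : (V ⊕ V) ⊕ Fin r ≃ Fin (2 * m + 2) := Fintype.equivFinOfCardEq hcardP
  refine ⟨P.submatrix eqv.symm eqv.symm, hPsymm.submatrix _, fun i j => ?_, ?_⟩
  · rw [Matrix.submatrix_apply]
    exact hPaff _ _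
  · rw [Matrix.det_submatrix_equiv_self, hdetP]

/-! ## GKKP Theorem 6: weighted minimized weakly-skew circuits (constants on the edges) -/

namespace GKKP2011

namespace Thm4

section WeightedShape

variable {k : Type*} {σ : Type*} (C : Circuit k σ)

/-- An input gate is its own sub-circuit. [cite: GrenetEtAl2011, Def 2] -/
private theorem eq_of_inSubCircuit_of_argsAt_nil {q r : ℕ} (h : C.InSubCircuit q r)
    (hr : C.argsAt r = []) : q = r := by
  induction h with
  | refl => rfl
  | tail _ hw _ =>
    unfold Circuit.IsArg at hw
    rw [hr] at hw
    simp at hw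

/-- A constant input gate is variable-free (a "constant argument" in Lemma 5's sense).
[cite: GrenetEtAl2011, Lemma 5] -/
private theorem isVarFreeAt_of_const {r : ℕ} {c : k} (hr : C.gates[r]? = some (.const c)) :
    C.IsVarFreeAt r := by
  intro q hq ⟨x, hx⟩
  have hqr : q = r := eq_of_inSubCircuit_of_argsAt_nil C hq (by rw [argsAt_eq C hr]; rfl)
  subst hqr
  rw [hr] at hx
  cases hx

/-- Counting gates of a given kind by index = counting them in the list. [folklore] -/
private theorem card_filter_range_eq_countP {α : Type*} (l : List α) (p : α → Bool) :
    ((Finset.range l.length).filter (fun q => (l[q]?.map p).getD false = true)).card =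
      l.countP p := by
  induction l using List.reverseRecOn with
  | nil => simp
  | append_singleton l x ih =>
    rw [List.length_append, List.length_singleton, Finset.range_add_one, Finset.filter_insert,
      List.countP_append]
    have hcongr : ((Finset.range l.length).filter
        (fun q => ((l ++ [x])[q]?.map p).getD false = true)) =
        (Finset.range l.length).filter (fun q => (l[q]?.map p).getD false = true) := by
      refine Finset.filter_congr fun q hq => ?_
      rw [Finset.mem_range] at hq
      rw [List.getElem?_append_left hq]
    have hlast : (((l ++ [x])[l.length]?.map p).getD false = true) ↔ p x = true := by
      rw [List.getElem?_concat_length]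
      simp
    have hnot : l.length ∉ (Finset.range l.length).filter
        (fun q => (l[q]?.map p).getD false = true) := by simp
    by_cases hpx : p x = true
    · rw [if_pos (hlast.2 hpx), hcongr, Finset.card_insert_of_notMem hnot, ih]
      simp [hpx]
    · rw [if_neg (fun h => hpx (hlast.1 h)), hcongr, ih]
      simp [hpx]

open Classical in
/-- The matched pairs of the weighted construction are indexed by addition gates and variable
inputs only: their number in `{0, …, m-1}` is at most `e + i` (skinny size + variable inputs).
[cite: GrenetEtAl2011, Thm 6 (proof)] -/
private theorem card_pairGates_le :
    ((Finset.range C.fatSize).filter (fun q => (∃ x, C.gates[q]? = some (.var x)) ∨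
      ∃ (c₁ : k) (i : ℕ) (c₂ : k) (j : ℕ), C.gates[q]? = some (.add c₁ i c₂ j))).card ≤
      C.skinnySize + C.numVarInputs := by
  have hsub : (Finset.range C.fatSize).filter (fun q => (∃ x, C.gates[q]? = some (.var x)) ∨
      ∃ (c₁ : k) (i : ℕ) (c₂ : k) (j : ℕ), C.gates[q]? = some (.add c₁ i c₂ j)) ⊆
      (Finset.range C.gates.length).filter
        (fun q => (C.gates[q]?.map Node.isComputation).getD false = true) ∪
      (Finset.range C.gates.length).filter
        (fun q => (C.gates[q]?.map Node.isVarInput).getD false = true) := by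
    intro q hq
    rw [Finset.mem_filter] at hq
    rw [Finset.mem_union, Finset.mem_filter, Finset.mem_filter]
    rcases hq.2 with ⟨x, hx⟩ | ⟨c₁, i, c₂, j, h⟩
    · refine Or.inr ⟨hq.1, ?_⟩
      rw [hx]
      rfl
    · refine Or.inl ⟨hq.1, ?_⟩
      rw [h]
      rfl
  refine (Finset.card_le_card hsub).trans ((Finset.card_union_le _ _).trans ?_)
  rw [card_filter_range_eq_countP, card_filter_range_eq_countP]
  rfl

end WeightedShape

section Weighted

variable {k : Type*} [Field k] {σ : Type*} (C : Circuit k σ)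

open Classical in
/-- **GKKP 2011, Theorem 6 — the weighted graph with constants (eq. (5) of the proof, p0015).**
For a MINIMIZED weighted weakly-skew circuit and every argument-closed set `T` of its gates there
is a graph (pairs `V`, links `-1` and weighted edges `X` with inverse `G`, `det X = ±1`, source
edges `a`; weights inputs of `C` or constants of `k`) with at most as many pairs as `T` has
addition gates and variable inputs (constant inputs are absorbed on the `s`-edges, multiplication
gates cost nothing), such that every non-constant gate `q` reusable in `T` has a vertex `t_q` and
a constant `c_q` with `c_q · (-(a X⁻¹)_{t_q}) = f_q` ("for every reusable gate `α`, there exists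
a constant `c_α` such that `c_α · Σ_{acceptable s–t_α paths} (-1)^{(|P|-1)/2} w(P) = f_α`").
Gadgets as printed: addition with a constant argument `β` (arrow weight `c₁`) ↦ edge `s v_α` of
weight `c₁` and `t_γ v_α` of weight `c₂c_γ`; addition of non-constant `β, γ` ↦ `t_β v_α`,
`t_γ v_α` of weights `c₁c_β`, `c₂c_γ` (one edge of the summed weight if `t_β = t_γ`);
multiplication ↦ gluing with `c_α = c₁c₂c_βc_γ`. [cite: GrenetEtAl2011, Thm 6 (proof)] -/
theorem exists_weighted_graph (hwf : C.WellFormed) (hmin : C.IsMinimized)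
    (hws : ∀ (a : ℕ) (c₁ : k) (i : ℕ) (c₂ : k) (j : ℕ),
      C.gates[a]? = some (.mul c₁ i c₂ j) → C.IsClosedArg a i ∨ C.IsClosedArg a j) (n : ℕ) :
    ∀ T : Finset ℕ, T.card = n → (∀ v ∈ T, v < C.fatSize) →
      (∀ v ∈ T, ∀ r ∈ C.argsAt v, r ∈ T) →
      ∃ (V : Type) (_ : Fintype V) (_ : DecidableEq V) (X G : Matrix V V (MvPolynomial σ k))
        (a : V → MvPolynomial σ k),
        Fintype.card V ≤ (T.filter (fun q => (∃ x, C.gates[q]? = some (.var x)) ∨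
          ∃ (c₁ : k) (i : ℕ) (c₂ : k) (j : ℕ), C.gates[q]? = some (.add c₁ i c₂ j))).card ∧
        X * G = 1 ∧ X.det ^ 2 = 1 ∧
        (∀ u v, C.IsInput (X u v) ∨ ∃ c : k, X u v = MvPolynomial.C c) ∧
        (∀ u, C.IsInput (a u) ∨ ∃ c : k, a u = MvPolynomial.C c) ∧
        ∀ q ∈ T, (∀ δ ∈ T, ∀ (c₁ : k) (i : ℕ) (c₂ : k) (j : ℕ),
          C.gates[δ]? = some (.mul c₁ i c₂ j) → ∀ b, (b = i ∨ b = j) → C.IsClosedArg δ b →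
          ¬ C.InSubCircuit q b) → ¬ C.IsConstInputAt q →
          ∃ u, ∃ c : k, MvPolynomial.C c * -((a ᵥ* G) u) =
            (Circuit.gateValues C.gates).getD q 0 := by
  classical
  obtain ⟨hmin1, hmin2, hmin3⟩ := hmin
  induction n using Nat.strong_induction_on with
  | _ n ih =>
  intro T hTn hTm hTc
  have ok0 : C.IsInput (0 : MvPolynomial σ k) ∨ ∃ c : k, (0 : MvPolynomial σ k) =
      MvPolynomial.C c := Or.inr ⟨0, (map_zero _).symm⟩
  have okn : C.IsInput (-1 : MvPolynomial σ k) ∨ ∃ c : k, (-1 : MvPolynomial σ k) =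
      MvPolynomial.C c := Or.inr ⟨-1, by simp⟩
  rcases T.eq_empty_or_nonempty with hT0 | hne
  · subst hT0
    refine ⟨Fin 0, inferInstance, inferInstance, 1, 1, Fin.elim0, by simp, Matrix.one_mul _,
      by simp, fun u => u.elim0, fun u => u.elim0, fun q hq => ?_⟩
    simp at hq
  set α := T.max' hne with hα
  have hαT : α ∈ T := T.max'_mem hne
  set T' := T.erase α with hT'
  have hαT' : α ∉ T' := Finset.notMem_erase α T
  have hT'card : T'.card = n - 1 := by rw [hT', Finset.card_erase_of_mem hαT, hTn]
  have hn : 0 < n := by rw [← hTn]; exact Finset.card_pos.2 hne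
  have hins : insert α T' = T := Finset.insert_erase hαT
  have hT'm : ∀ v ∈ T', v < C.fatSize := fun v hv => hTm v (Finset.mem_of_mem_erase hv)
  have hT'c : ∀ v ∈ T', ∀ r ∈ C.argsAt v, r ∈ T' := by
    intro v hv r hr
    have hrv : r < v := lt_of_mem_argsAt C hwf hr
    have hvα : v ≤ α := T.le_max' v (Finset.mem_of_mem_erase hv)
    exact Finset.mem_erase.2 ⟨by omega, hTc v (Finset.mem_of_mem_erase hv) r hr⟩
  have hargs : ∀ r ∈ C.argsAt α, r ∈ T' := by
    intro r hr
    have hrα : r < α := lt_of_mem_argsAt C hwf hr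
    exact Finset.mem_erase.2 ⟨by omega, hTc α hαT r hr⟩
  have hT'sub : T' ⊆ T := Finset.erase_subset α T
  -- the pair count is monotone
  have hmono : ∀ {S₁ S₂ : Finset ℕ}, S₁ ⊆ S₂ →
      (S₁.filter (fun q => (∃ x, C.gates[q]? = some (.var x)) ∨
        ∃ (c₁ : k) (i : ℕ) (c₂ : k) (j : ℕ), C.gates[q]? = some (.add c₁ i c₂ j))).card ≤
      (S₂.filter (fun q => (∃ x, C.gates[q]? = some (.var x)) ∨
        ∃ (c₁ : k) (i : ℕ) (c₂ : k) (j : ℕ), C.gates[q]? = some (.add c₁ i c₂ j))).card :=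
    fun h => Finset.card_le_card (Finset.filter_subset_filter _ h)
  -- a pair gate `α` adds one to the count
  have hcount : ((∃ x, C.gates[α]? = some (.var x)) ∨
      ∃ (c₁ : k) (i : ℕ) (c₂ : k) (j : ℕ), C.gates[α]? = some (.add c₁ i c₂ j)) →
      (T'.filter (fun q => (∃ x, C.gates[q]? = some (.var x)) ∨
        ∃ (c₁ : k) (i : ℕ) (c₂ : k) (j : ℕ), C.gates[q]? = some (.add c₁ i c₂ j))).card + 1 =
      (T.filter (fun q => (∃ x, C.gates[q]? = some (.var x)) ∨
        ∃ (c₁ : k) (i : ℕ) (c₂ : k) (j : ℕ), C.gates[q]? = some (.add c₁ i c₂ j))).card := by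
    intro hP
    rw [← hins, Finset.filter_insert, if_pos hP, Finset.card_insert_of_notMem]
    exact fun h => hαT' (Finset.mem_filter.1 h).1
  obtain ⟨g, hg⟩ : ∃ g, C.gates[α]? = some g :=
    ⟨C.gates[α]'(hTm α hαT), List.getElem?_eq_getElem _⟩
  have hgmem : g ∈ C.gates := List.mem_of_getElem? hg
  have hval := getD_gateValues C.gates α g hg
  -- the graph of `T'`
  obtain ⟨V, _, _, X, G, a, hcard, hXG, hdet, hX, ha, hold⟩ :=
    ih (n - 1) (by omega) T' hT'card hT'm hT'c
  -- reusability in `T` of a gate of `T'` gives reusability in `T'`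
  have hreusT' : ∀ q, (∀ δ ∈ T, ∀ (c₁ : k) (i : ℕ) (c₂ : k) (j : ℕ),
      C.gates[δ]? = some (.mul c₁ i c₂ j) → ∀ b, (b = i ∨ b = j) → C.IsClosedArg δ b →
      ¬ C.InSubCircuit q b) → (∀ δ ∈ T', ∀ (c₁ : k) (i : ℕ) (c₂ : k) (j : ℕ),
      C.gates[δ]? = some (.mul c₁ i c₂ j) → ∀ b, (b = i ∨ b = j) → C.IsClosedArg δ b →
      ¬ C.InSubCircuit q b) := fun q h δ hδ => h δ (hT'sub hδ)
  cases g with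
  | const c =>
    -- a constant input: no pair, nothing owed
    refine ⟨V, inferInstance, inferInstance, X, G, a, hcard.trans (hmono hT'sub), hXG, hdet, hX,
      ha, fun q hq hreus hnc => ?_⟩
    have hqα : q ≠ α := fun h => hnc ⟨c, h ▸ hg⟩
    exact hold q (Finset.mem_erase.2 ⟨hqα, hq⟩) (hreusT' q hreus) hnc
  | var x =>
    refine ⟨V ⊕ Unit, inferInstance, inferInstance,
      Matrix.fromBlocks X (Matrix.of fun v (_ : Unit) => (0 : V → MvPolynomial σ k) v) 0
        (Matrix.of fun (_ _ : Unit) => -1),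
      Matrix.fromBlocks G (Matrix.of fun v (_ : Unit) => -((-1) * (G *ᵥ 0) v)) 0
        (Matrix.of fun (_ _ : Unit) => -1),
      Sum.elim a (fun _ => MvPolynomial.X x), ?_, newPair_mul_inv X G hXG 0 (-1) (by ring),
      ?_, ?_, ?_, ?_⟩
    · rw [card_newPair, ← hcount (Or.inl ⟨x, hg⟩)]; omega
    · rw [newPair_det, mul_pow, hdet]; ring
    · exact forall_fromBlocks (P := fun p => C.IsInput p ∨ ∃ c : k, p = MvPolynomial.C c) hX
        (fun _ _ => ok0) (fun _ _ => ok0) (fun _ _ => okn)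
    · exact forall_sumElim (P := fun p => C.IsInput p ∨ ∃ c : k, p = MvPolynomial.C c) ha
        (fun _ => Or.inl ⟨.var x, hgmem, rfl⟩)
    · intro q hq hreus hnc
      rw [newPair_vecMul]
      by_cases hqα : q = α
      · subst hqα
        refine ⟨Sum.inr (), 1, ?_⟩
        rw [Sum.elim_inr, hval, dotProduct_zero, sub_zero, map_one, one_mul]
        simp [Node.eval]
      · obtain ⟨u, e, hu⟩ := hold q (Finset.mem_erase.2 ⟨hqα, hq⟩) (hreusT' q hreus) hnc
        exact ⟨Sum.inl u, e, by rw [Sum.elim_inl]; exact hu⟩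
  | add c₁ i c₂ j =>
    obtain ⟨hnot, hvi, hvj⟩ := hmin2 α c₁ i c₂ j hg
    have hargs' : C.argsAt α = [i, j] := argsAt_eq C hg
    have hi : i ∈ C.argsAt α := by rw [hargs']; simp
    have hj : j ∈ C.argsAt α := by rw [hargs']; simp
    -- each argument `r` with arrow weight `w` contributes `x_r - y · c_r = w · f_r`
    have term : ∀ (r : ℕ) (w : k), r ∈ C.argsAt α → (C.IsVarFreeAt r → C.IsConstInputAt r) →
        ∃ (cv : V → MvPolynomial σ k) (x₀ : MvPolynomial σ k),
          (∀ v, ∃ e : k, cv v = MvPolynomial.C e) ∧ (∃ e : k, x₀ = MvPolynomial.C e) ∧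
          x₀ - (a ᵥ* G) ⬝ᵥ cv = MvPolynomial.C w * (Circuit.gateValues C.gates).getD r 0 := by
      intro r w hr hvf
      by_cases hfree : C.IsVarFreeAt r
      · obtain ⟨c, hc⟩ := hvf hfree
        obtain ⟨hc1, -⟩ := hmin1 r c hc
        subst hc1
        refine ⟨0, MvPolynomial.C w, fun _ => ⟨0, by simp⟩, ⟨w, rfl⟩, ?_⟩
        rw [dotProduct_zero, sub_zero, getD_gateValues C.gates r _ hc]
        simp [Node.eval]
      · have hnc : ¬ C.IsConstInputAt r := fun ⟨c, hc⟩ => hfree (isVarFreeAt_of_const C hc)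
        obtain ⟨u, e, hu⟩ := hold r (hargs r hr) (reusable_of_mem_argsAt C hT'c hαT' hr) hnc
        refine ⟨Pi.single u (MvPolynomial.C (w * e)), 0, fun v => ?_, ⟨0, by simp⟩, ?_⟩
        · by_cases hv : v = u
          · subst hv; exact ⟨w * e, by simp⟩
          · exact ⟨0, by simp [hv]⟩
        · rw [dotProduct_single, zero_sub, ← hu, map_mul]
          ring
    obtain ⟨cvi, xi, hcvi, ⟨ei, hxi⟩, hti⟩ := term i c₁ hi hvi
    obtain ⟨cvj, xj, hcvj, ⟨ej, hxj⟩, htj⟩ := term j c₂ hj hvj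
    have hcv : ∀ v, C.IsInput ((cvi + cvj) v) ∨ ∃ c : k, (cvi + cvj) v = MvPolynomial.C c := by
      intro v
      obtain ⟨e₁, h₁⟩ := hcvi v
      obtain ⟨e₂, h₂⟩ := hcvj v
      exact Or.inr ⟨e₁ + e₂, by rw [Pi.add_apply, h₁, h₂, map_add]⟩
    have hx₀ : C.IsInput (xi + xj) ∨ ∃ c : k, xi + xj = MvPolynomial.C c :=
      Or.inr ⟨ei + ej, by rw [hxi, hxj, map_add]⟩
    refine ⟨V ⊕ Unit, inferInstance, inferInstance,
      Matrix.fromBlocks X (Matrix.of fun v (_ : Unit) => (cvi + cvj) v) 0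
        (Matrix.of fun (_ _ : Unit) => -1),
      Matrix.fromBlocks G (Matrix.of fun v (_ : Unit) => -((-1) * (G *ᵥ (cvi + cvj)) v)) 0
        (Matrix.of fun (_ _ : Unit) => -1),
      Sum.elim a (fun _ => xi + xj), ?_, newPair_mul_inv X G hXG _ (-1) (by ring),
      ?_, ?_, ?_, ?_⟩
    · rw [card_newPair, ← hcount (Or.inr ⟨c₁, i, c₂, j, hg⟩)]; omega
    · rw [newPair_det, mul_pow, hdet]; ring
    · exact forall_fromBlocks (P := fun p => C.IsInput p ∨ ∃ c : k, p = MvPolynomial.C c) hX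
        (fun v _ => hcv v) (fun _ _ => ok0) (fun _ _ => okn)
    · exact forall_sumElim (P := fun p => C.IsInput p ∨ ∃ c : k, p = MvPolynomial.C c) ha
        (fun _ => hx₀)
    · intro q hq hreus hnc
      rw [newPair_vecMul]
      by_cases hqα : q = α
      · subst hqα
        refine ⟨Sum.inr (), 1, ?_⟩
        rw [Sum.elim_inr, hval, map_one, one_mul, dotProduct_add,
          show xi + xj - ((a ᵥ* G) ⬝ᵥ cvi + (a ᵥ* G) ⬝ᵥ cvj) =
            (xi - (a ᵥ* G) ⬝ᵥ cvi) + (xj - (a ᵥ* G) ⬝ᵥ cvj) by ring, hti, htj]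
        simp only [Node.eval, neg_mul, one_mul, neg_neg]
        rw [getD_gateValues_take _ (lt_of_mem_argsAt C hwf hi),
          getD_gateValues_take _ (lt_of_mem_argsAt C hwf hj)]
      · obtain ⟨u, e, hu⟩ := hold q (Finset.mem_erase.2 ⟨hqα, hq⟩) (hreusT' q hreus) hnc
        exact ⟨Sum.inl u, e, by rw [Sum.elim_inl]; exact hu⟩
  | mul c₁ i c₂ j =>
    obtain ⟨hvi, hvj⟩ := hmin3 α c₁ i c₂ j hg
    have hargs' : C.argsAt α = [i, j] := argsAt_eq C hg
    have key : ∀ b o : ℕ, (b = i ∧ o = j ∨ b = j ∧ o = i) → C.IsClosedArg α b →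
        ∃ (V : Type) (_ : Fintype V) (_ : DecidableEq V) (X G : Matrix V V (MvPolynomial σ k))
          (a : V → MvPolynomial σ k),
          Fintype.card V ≤ (T.filter (fun q => (∃ x, C.gates[q]? = some (.var x)) ∨
            ∃ (c₁ : k) (i : ℕ) (c₂ : k) (j : ℕ), C.gates[q]? = some (.add c₁ i c₂ j))).card ∧
          X * G = 1 ∧ X.det ^ 2 = 1 ∧
          (∀ u v, C.IsInput (X u v) ∨ ∃ c : k, X u v = MvPolynomial.C c) ∧
          (∀ u, C.IsInput (a u) ∨ ∃ c : k, a u = MvPolynomial.C c) ∧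
          ∀ q ∈ T, (∀ δ ∈ T, ∀ (c₁ : k) (i : ℕ) (c₂ : k) (j : ℕ),
            C.gates[δ]? = some (.mul c₁ i c₂ j) → ∀ b, (b = i ∨ b = j) → C.IsClosedArg δ b →
            ¬ C.InSubCircuit q b) → ¬ C.IsConstInputAt q →
            ∃ u, ∃ c : k, MvPolynomial.C c * -((a ᵥ* G) u) =
              (Circuit.gateValues C.gates).getD q 0 := by
      intro b o hbo hclb
      have hb : b ∈ C.argsAt α := by rw [hargs']; rcases hbo with ⟨rfl, -⟩ | ⟨rfl, -⟩ <;> simp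
      have ho : o ∈ C.argsAt α := by rw [hargs']; rcases hbo with ⟨-, rfl⟩ | ⟨-, rfl⟩ <;> simp
      have hbnf : ¬ C.IsVarFreeAt b := by rcases hbo with ⟨rfl, -⟩ | ⟨rfl, -⟩ <;> assumption
      have honf : ¬ C.IsVarFreeAt o := by rcases hbo with ⟨-, rfl⟩ | ⟨-, rfl⟩ <;> assumption
      have hbnc : ¬ C.IsConstInputAt b := fun ⟨c, hc⟩ => hbnf (isVarFreeAt_of_const C hc)
      have honc : ¬ C.IsConstInputAt o := fun ⟨c, hc⟩ => honf (isVarFreeAt_of_const C hc)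
      have hob : ¬ C.InSubCircuit o b := by
        refine not_inSubCircuit_other C hwf hclb hb ho fun hob => ?_
        rw [hargs']
        rcases hbo with ⟨rfl, rfl⟩ | ⟨rfl, rfl⟩ <;> subst hob <;> simp
      set T₁ := T'.filter (fun q => C.InSubCircuit q b) with hT₁
      set T₂ := T'.filter (fun q => ¬ C.InSubCircuit q b) with hT₂
      have hcardT : T₁.card + T₂.card = T'.card := Finset.card_filter_add_card_filter_not _
      have hT₁m : ∀ v ∈ T₁, v < C.fatSize := fun v hv => hT'm v (Finset.mem_filter.1 hv).1
      have hT₂m : ∀ v ∈ T₂, v < C.fatSize := fun v hv => hT'm v (Finset.mem_filter.1 hv).1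
      have hT₁c : ∀ v ∈ T₁, ∀ r ∈ C.argsAt v, r ∈ T₁ := by
        intro v hv r hr
        obtain ⟨hvT, hvb⟩ := Finset.mem_filter.1 hv
        exact Finset.mem_filter.2 ⟨hT'c v hvT r hr, inSubCircuit_of_mem_argsAt C hvb hr⟩
      have hT₂c : ∀ v ∈ T₂, ∀ r ∈ C.argsAt v, r ∈ T₂ := by
        intro v hv r hr
        obtain ⟨hvT, hvb⟩ := Finset.mem_filter.1 hv
        have hvα : v ≠ α := fun h => hαT' (h ▸ hvT)
        exact Finset.mem_filter.2
          ⟨hT'c v hvT r hr, not_inSubCircuit_of_mem_argsAt C hclb hvb hvα hr⟩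
      have hbT₁ : b ∈ T₁ := Finset.mem_filter.2 ⟨hargs b hb, Relation.ReflTransGen.refl⟩
      have hoT₂ : o ∈ T₂ := Finset.mem_filter.2 ⟨hargs o ho, hob⟩
      have hαT₂ : α ∉ T₂ := fun h => hαT' (Finset.mem_filter.1 h).1
      have hT₁sub : T₁ ⊆ T' := Finset.filter_subset _ _
      have hT₂sub : T₂ ⊆ T' := Finset.filter_subset _ _
      obtain ⟨V₁, _, _, X₁, G₁, a₁, hcard₁, hXG₁, hdet₁, hX₁, ha₁, hold₁⟩ :=
        ih _ (by omega) T₁ rfl hT₁m hT₁c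
      obtain ⟨V₂, _, _, X₂, G₂, a₂, hcard₂, hXG₂, hdet₂, hX₂, ha₂, hold₂⟩ :=
        ih _ (by omega) T₂ rfl hT₂m hT₂c
      obtain ⟨ub, eb, hub⟩ := hold₁ b hbT₁
        (reusable_top C hwf fun q hq => (Finset.mem_filter.1 hq).2) hbnc
      obtain ⟨uo, eo, huo⟩ := hold₂ o hoT₂ (reusable_of_mem_argsAt C hT₂c hαT₂ ho) honc
      -- the pair counts of `T₁` and `T₂` add up
      have hsplit : (T₁.filter (fun q => (∃ x, C.gates[q]? = some (.var x)) ∨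
            ∃ (c₁ : k) (i : ℕ) (c₂ : k) (j : ℕ), C.gates[q]? = some (.add c₁ i c₂ j))).card +
          (T₂.filter (fun q => (∃ x, C.gates[q]? = some (.var x)) ∨
            ∃ (c₁ : k) (i : ℕ) (c₂ : k) (j : ℕ), C.gates[q]? = some (.add c₁ i c₂ j))).card ≤
          (T.filter (fun q => (∃ x, C.gates[q]? = some (.var x)) ∨
            ∃ (c₁ : k) (i : ℕ) (c₂ : k) (j : ℕ), C.gates[q]? = some (.add c₁ i c₂ j))).card := by
        rw [← Finset.card_union_of_disjoint]
        · refine Finset.card_le_card ?_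
          rw [← Finset.filter_union]
          exact Finset.filter_subset_filter _
            (Finset.union_subset (hT₁sub.trans hT'sub) (hT₂sub.trans hT'sub))
        · exact Finset.disjoint_filter_filter (Finset.disjoint_filter_filter_not T' T' _)
      refine ⟨V₂ ⊕ V₁, inferInstance, inferInstance,
        Matrix.fromBlocks X₂ (Matrix.of fun u v => if u = uo then a₁ v else 0) 0 X₁,
        Matrix.fromBlocks G₂ (-(G₂ * (Matrix.of fun u v => if u = uo then a₁ v else 0) * G₁)) 0 G₁,
        Sum.elim a₂ 0, ?_, glue_mul_inv X₂ G₂ hXG₂ X₁ G₁ hXG₁ uo a₁, ?_, ?_, ?_, ?_⟩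
      · rw [card_glue]; omega
      · rw [glue_det, mul_pow, hdet₁, hdet₂, one_mul]
      · refine forall_fromBlocks (P := fun p => C.IsInput p ∨ ∃ c : k, p = MvPolynomial.C c)
          hX₂ (fun u v => ?_) (fun _ _ => ok0) hX₁
        simp only [Matrix.of_apply]
        split_ifs
        · exact ha₁ v
        · exact ok0
      · exact forall_sumElim (P := fun p => C.IsInput p ∨ ∃ c : k, p = MvPolynomial.C c) ha₂
          (fun _ => ok0)
      · intro q hq hreus hnc
        by_cases hqα : q = α
        · subst hqα
          refine ⟨Sum.inr ub, c₁ * c₂ * eb * eo, ?_⟩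
          rw [glue_vecMul, Sum.elim_inr, neg_neg, hval]
          have hprod : MvPolynomial.C (c₁ * c₂ * eb * eo) * ((a₂ ᵥ* G₂) uo * (a₁ ᵥ* G₁) ub) =
              MvPolynomial.C c₁ * MvPolynomial.C c₂ *
                ((MvPolynomial.C eb * -((a₁ ᵥ* G₁) ub)) *
                  (MvPolynomial.C eo * -((a₂ ᵥ* G₂) uo))) := by
            simp only [map_mul]
            ring
          rw [hprod, hub, huo]
          simp only [Node.eval]
          rw [getD_gateValues_take _ (lt_of_mem_argsAt C hwf (hargs' ▸ by simp : i ∈ C.argsAt α)),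
            getD_gateValues_take _ (lt_of_mem_argsAt C hwf (hargs' ▸ by simp : j ∈ C.argsAt α))]
          rcases hbo with ⟨rfl, rfl⟩ | ⟨rfl, rfl⟩ <;> ring
        · have hqT' : q ∈ T' := Finset.mem_erase.2 ⟨hqα, hq⟩
          have hqb : ¬ C.InSubCircuit q b :=
            hreus α hαT c₁ i c₂ j hg b (by rcases hbo with ⟨h, -⟩ | ⟨h, -⟩ <;> simp [h]) hclb
          have hqT₂ : q ∈ T₂ := Finset.mem_filter.2 ⟨hqT', hqb⟩
          obtain ⟨u, e, hu⟩ := hold₂ q hqT₂ (fun δ hδ =>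
            hreus δ (hT'sub (Finset.mem_filter.1 hδ).1)) hnc
          refine ⟨Sum.inl u, e, ?_⟩
          rw [glue_vecMul]
          exact hu
    rcases hws α c₁ i c₂ j hg with h | h
    · exact key i j (Or.inl ⟨rfl, rfl⟩) h
    · exact key j i (Or.inr ⟨rfl, rfl⟩) h

end Weighted

end Thm4

end GKKP2011

/-- **Grenet–Kaltofen–Koiran–Portier 2011, Theorem 6** — discharge of the named fact
`GKKP2011_thm6`: over a field with `2 ≠ 0`, a polynomial computed by a MINIMIZED weighted
weakly-skew circuit with `e` computation gates and `i` variable inputs is the determinant of a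
symmetric matrix of dimension `≤ 2(e+i) + 1` whose entries are inputs of the circuit or constants
— GKKP's weighted graph (proof of Thm. 6: Lemma 4 with the constants `c_α`, the output edge
`st` carrying "the constant associated to the output gate" times `½`), its determinant computed
by a Schur complement. [cite: GrenetEtAl2011, Thm 6] -/
theorem GKKP2011_thm6_holds : GKKP2011_thm6 := by
  intro k _ h2 σ C hws hmin
  obtain ⟨⟨hwf, hne, -⟩, hws'⟩ := hws
  have hfs : C.fatSize = C.gates.length := rfl
  have hm : 0 < C.fatSize := by rw [hfs]; exact List.length_pos_iff.2 hne
  set m := C.fatSize with hmdef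
  obtain ⟨g, hg⟩ : ∃ g, C.gates[m - 1]? = some g :=
    ⟨C.gates[m - 1]'(by rw [← hfs]; omega), List.getElem?_eq_getElem _⟩
  have heval : C.eval = (GKKP2011.Circuit.gateValues C.gates).getD (m - 1) 0 := by
    rw [GKKP2011.Circuit.eval, List.getLastD_eq_getLast?, List.getLast?_eq_getElem?,
      List.getD_eq_getElem?_getD, GKKP2011.Circuit.length_gateValues]
    rfl
  -- a constant output: the `1 × 1` matrix `(c)`
  by_cases hconst : C.IsConstInputAt (m - 1)
  · obtain ⟨c, hc⟩ := hconst
    refine ⟨1, by omega, !![MvPolynomial.C c], ?_, fun a b => Or.inr ⟨c, ?_⟩, ?_⟩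
    · refine Matrix.IsSymm.ext fun a b => ?_
      fin_cases a; fin_cases b; rfl
    · fin_cases a; fin_cases b; rfl
    · rw [Matrix.det_fin_one, heval, GKKP2011.Thm4.getD_gateValues C.gates (m - 1) _ hc]
      rfl
  -- otherwise: the weighted graph of the whole circuit and GKKP's layout
  have hTc : ∀ v ∈ Finset.range m, ∀ r ∈ C.argsAt v, r ∈ Finset.range m := by
    intro v hv r hr
    have := GKKP2011.Thm4.lt_of_mem_argsAt C hwf hr
    rw [Finset.mem_range] at hv ⊢
    omega
  obtain ⟨V, _, _, X, G, a, hcard, hXG, hdet, hX, ha, hval⟩ :=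
    GKKP2011.Thm4.exists_weighted_graph C hwf hmin hws' m (Finset.range m) (Finset.card_range m)
      (fun v hv => Finset.mem_range.1 hv) hTc
  obtain ⟨u, e, hu⟩ := hval (m - 1) (Finset.mem_range.2 (by omega)) (by
    intro δ hδ c₁ i c₂ j hδg b hb _ hsub
    have hbargs : b ∈ C.argsAt δ := by
      rw [GKKP2011.Thm4.argsAt_eq C hδg]
      rcases hb with rfl | rfl <;> simp [GKKP2011.Node.args]
    have h1 := GKKP2011.Thm4.lt_of_inSubCircuit_of_mem_argsAt C hwf hsub hbargs
    have h2 := Finset.mem_range.1 hδ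
    omega) hconst
  have hsize : Fintype.card V ≤ C.skinnySize + C.numVarInputs :=
    hcard.trans (GKKP2011.Thm4.card_pairGates_le C)
  -- the edge `s t` of weight `½ · (-1)^{|V|} · c_out`
  set η : MvPolynomial σ k := MvPolynomial.C (2⁻¹ * (-1) ^ Fintype.card V * e) with hη
  set h : V → MvPolynomial σ k := Pi.single u η with hh
  set M := Matrix.fromBlocks (0 : Matrix Unit Unit (MvPolynomial σ k))
    (Matrix.of fun _ => Sum.elim a h) (Matrix.of fun uv (_ : Unit) => Sum.elim a h uv)
    (Matrix.fromBlocks 0 Xᵀ X 0) with hM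
  have hdetM : M.det = C.eval := by
    rw [hM, GKKP2011.Thm4.det_layout X G hXG hdet a h, hh, dotProduct_single, heval, ← hu, hη]
    have hsq : ((-1 : MvPolynomial σ k) ^ Fintype.card V) * (-1) ^ Fintype.card V = 1 := by
      rw [← pow_add, ← two_mul, pow_mul, neg_one_sq, one_pow]
    have hhalf : (2 : MvPolynomial σ k) * MvPolynomial.C (2⁻¹ : k) = 1 := by
      rw [show (2 : MvPolynomial σ k) = MvPolynomial.C 2 from (map_ofNat MvPolynomial.C 2).symm,
        ← MvPolynomial.C_mul, mul_inv_cancel₀ h2, MvPolynomial.C_1]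
    simp only [map_mul, map_pow, map_neg, map_one, pow_succ]
    linear_combination (-(MvPolynomial.C e * (a ᵥ* G) u)) * hsq * 1 +
      ((-1) ^ Fintype.card V * (-1) ^ Fintype.card V * (MvPolynomial.C e * (a ᵥ* G) u)) *
        (0 : MvPolynomial σ k) * hhalf +
      (-((-1) ^ Fintype.card V * (-1) ^ Fintype.card V * MvPolynomial.C e * (a ᵥ* G) u)) * hhalf
  let P : MvPolynomial σ k → Prop := fun p => C.IsInput p ∨ ∃ c : k, p = MvPolynomial.C c
  have ok0 : P 0 := Or.inr ⟨0, (map_zero _).symm⟩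
  have hentries : ∀ x y, P (M x y) := by
    have hhok : ∀ v, P (h v) := by
      intro v
      show C.IsInput (h v) ∨ ∃ c : k, h v = MvPolynomial.C c
      rw [hh, Pi.single_apply]
      split_ifs
      · exact Or.inr ⟨_, hη⟩
      · exact ok0
    have hbord : ∀ uv, P (Sum.elim a h uv) := GKKP2011.Thm4.forall_sumElim (P := P) ha hhok
    refine GKKP2011.Thm4.forall_fromBlocks (P := P) (fun _ _ => ok0) (fun _ uv => hbord uv)
      (fun uv _ => hbord uv) ?_
    exact GKKP2011.Thm4.forall_fromBlocks (P := P) (fun _ _ => ok0) (fun x y => hX y x) hX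
      (fun _ _ => ok0)
  let eqv : Unit ⊕ (V ⊕ V) ≃ Fin (2 * Fintype.card V + 1) :=
    Fintype.equivFinOfCardEq GKKP2011.Thm4.card_layout
  refine ⟨2 * Fintype.card V + 1, by omega, M.submatrix eqv.symm eqv.symm,
    (GKKP2011.Thm4.isSymm_layout X a h).submatrix _, fun x y => ?_, ?_⟩
  · rw [Matrix.submatrix_apply]
    exact hentries _ _
  · rw [Matrix.det_submatrix_equiv_self, hdetM]

/-! ## Tree-vocabulary corollaries (dc / sdc bounds from weakly-skew circuits) -/

namespace GKKP2011

namespace Thm4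

section Corollaries

variable {k : Type*} [Field k] {σ : Type*} (C : Circuit k σ)

/-- **Universality of the determinant for weakly-skew circuits, from the graph of Lemma 4**: a
polynomial with a classical weakly-skew circuit of fat size `m` has an AFFINE determinantal
representation of size exactly `m` (the Cramer matrix `Thm4.det_updateRow_eq` of the graph of
the whole circuit, one row rescaled by the unit `-det X = ∓1`, padded by an identity block) —
the role played in GKKP §1.1/§5.1 by Malod–Portier's "weakly-skew circuit of fat size `m` ↦
determinant of size `m+1`", here one size smaller and over any field. [cite: GrenetEtAl2011, §5.1] -/
theorem hasDetRepr_fatSize (hcl : C.IsClassical) (hws : C.IsWeaklySkew) :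
    HasDetRepr C.eval C.fatSize := by
  obtain ⟨⟨hwf, hne, -⟩, hws'⟩ := hws
  have hfs : C.fatSize = C.gates.length := rfl
  have hm : 0 < C.fatSize := by rw [hfs]; exact List.length_pos_iff.2 hne
  set m := C.fatSize with hmdef
  have hTc : ∀ v ∈ Finset.range m, ∀ r ∈ C.argsAt v, r ∈ Finset.range m := by
    intro v hv r hr
    have := lt_of_mem_argsAt C hwf hr
    rw [Finset.mem_range] at hv ⊢
    omega
  obtain ⟨V, _, _, X, G, a, hcard, hXG, hdet, hX, ha, hval⟩ :=
    exists_graph C hwf hcl hws' m (Finset.range m) (Finset.card_range m)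
      (fun v hv => Finset.mem_range.1 hv) hTc
  obtain ⟨u, hu⟩ := hval (m - 1) (Finset.mem_range.2 (by omega)) (by
    intro δ hδ c₁ i c₂ j hδg b hb _ hsub
    have hbargs : b ∈ C.argsAt δ := by
      rw [argsAt_eq C hδg]
      rcases hb with rfl | rfl <;> simp [Node.args]
    have h1 := lt_of_inSubCircuit_of_mem_argsAt C hwf hsub hbargs
    have h2 := Finset.mem_range.1 hδ
    omega)
  have heval : C.eval = (Circuit.gateValues C.gates).getD (m - 1) 0 := by
    rw [Circuit.eval, List.getLastD_eq_getLast?, List.getLast?_eq_getElem?,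
      List.getD_eq_getElem?_getD, Circuit.length_gateValues]
    rfl
  -- `det X = ±1`; rescale the Cramer row by `-det X`
  have hdx : X.det = 1 ∨ X.det = -1 := mul_self_eq_one_iff.1 (by rw [← pow_two]; exact hdet)
  set K := X.updateRow u ((-X.det) • a) with hK
  have hdetK : K.det = C.eval := by
    rw [hK, Matrix.det_updateRow_smul, det_updateRow_eq X G hXG a u, heval, ← hu]
    have : -X.det * (X.det * (a ᵥ* G) u) = -(X.det ^ 2) * (a ᵥ* G) u := by ring
    rw [this, hdet, neg_one_mul]
  have hKaff : ∀ i j, (K i j).totalDegree ≤ 1 := by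
    intro i j
    rw [hK]
    by_cases hi : i = u
    · subst hi
      rw [Matrix.updateRow_self, Pi.smul_apply, smul_eq_mul]
      rcases hdx with h | h
      · rw [h, neg_one_mul, totalDegree_neg]; exact totalDegree_le_one_of_ok C (ha j)
      · rw [h, neg_neg, one_mul]; exact totalDegree_le_one_of_ok C (ha j)
    · rw [Matrix.updateRow_ne hi]
      exact totalDegree_le_one_of_ok C (hX i j)
  -- identity padding to size exactly `m`
  obtain ⟨r, hr⟩ : ∃ r, Fintype.card V + r = m := ⟨m - Fintype.card V, by omega⟩
  set P := Matrix.fromBlocks K 0 0 (1 : Matrix (Fin r) (Fin r) (MvPolynomial σ k)) with hP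
  have hdetP : P.det = C.eval := by rw [hP, det_fromBlocks_zero₂₁, det_one, mul_one, hdetK]
  have hPaff : ∀ i j, (P i j).totalDegree ≤ 1 := by
    rintro (i | i) (j | j)
    · simpa [hP] using hKaff i j
    · simp [hP]
    · simp [hP]
    · simp only [hP, Matrix.fromBlocks_apply₂₂, Matrix.one_apply]
      split_ifs <;> simp
  have hcardP : Fintype.card (V ⊕ Fin r) = m := by
    simp only [Fintype.card_sum, Fintype.card_fin, hr]
  let eqv : V ⊕ Fin r ≃ Fin m := Fintype.equivFinOfCardEq hcardP
  refine ⟨P.submatrix eqv.symm eqv.symm, fun i j => ?_, ?_⟩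
  · rw [Matrix.submatrix_apply]
    exact hPaff _ _
  · rw [Matrix.det_submatrix_equiv_self, hdetP]

/-- `dc(f) ≤ m` for every `f` with a classical weakly-skew circuit of fat size `m` (over a field).
[cite: GrenetEtAl2011, §5.1] -/
theorem determinantalComplexity_le_fatSize (hcl : C.IsClassical) (hws : C.IsWeaklySkew) :
    determinantalComplexity C.eval ≤ C.fatSize :=
  determinantalComplexity_le_of_hasDetRepr (hasDetRepr_fatSize C hcl hws)

end Corollaries

section CorollariesSdc

variable {k : Type} [Field k] {σ : Type} (C : Circuit k σ)

/-- **GKKP Thm. 4, unconditional, in the tree's vocabulary**: `sdc(f) ≤ 2m + 1` for every `f`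
with a classical weakly-skew circuit of fat size `m`, over a field with `2 ≠ 0` — the V1
dictionary entry "weakly-skew circuit ⇒ symmetric affine pencil". [cite: GrenetEtAl2011, Thm 4] -/
theorem symmDeterminantalComplexity_le_of_isWeaklySkew (h2 : (2 : k) ≠ 0) (hcl : C.IsClassical)
    (hws : C.IsWeaklySkew) : symmDeterminantalComplexity C.eval ≤ 2 * C.fatSize + 1 := by
  obtain ⟨N, hN, A, hsymm, hent, hdetA⟩ := GKKP2011_thm4_holds _ h2 _ C hcl hws
  refine (symmDeterminantalComplexity_le ⟨A, hsymm, fun i j => ?_, hdetA⟩).trans hN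
  exact totalDegree_le_one_of_ok C (hent i j)

/-- **GKKP Thm. 6, unconditional, in the tree's vocabulary**: `sdc(f) ≤ 2(e + i) + 1` for every
`f` with a minimized weighted weakly-skew circuit with `e` computation gates and `i` variable
inputs, over a field with `2 ≠ 0`. [cite: GrenetEtAl2011, Thm 6] -/
theorem symmDeterminantalComplexity_le_of_isMinimized (h2 : (2 : k) ≠ 0)
    (hws : C.IsWeaklySkew) (hmin : C.IsMinimized) :
    symmDeterminantalComplexity C.eval ≤ 2 * (C.skinnySize + C.numVarInputs) + 1 := by
  obtain ⟨N, hN, A, hsymm, hent, hdetA⟩ := GKKP2011_thm6_holds _ h2 _ C hws hmin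
  refine (symmDeterminantalComplexity_le ⟨A, hsymm, fun i j => ?_, hdetA⟩).trans hN
  rcases hent i j with h | ⟨c, hc⟩
  · exact h.totalDegree_le_one
  · rw [hc, totalDegree_C]; exact Nat.zero_le _

/-- **GKKP Prop. 1, unconditional, in the tree's vocabulary**: in characteristic `2`,
`sdc(p²) ≤ 2m + 2` for every `p` with a classical weakly-skew circuit of fat size `m`.
[cite: GrenetEtAl2011, Prop 1] -/
theorem symmDeterminantalComplexity_sq_le_of_charTwo [CharP k 2] (hcl : C.IsClassical)
    (hws : C.IsWeaklySkew) : symmDeterminantalComplexity (C.eval ^ 2) ≤ 2 * C.fatSize + 2 :=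
  GKKP2011_prop1.sdc_sq_le GKKP2011_prop1_holds _ _ C hcl hws

end CorollariesSdc

end Thm4

end GKKP2011

end Literature.Computability.AlgebraicComplexity

end
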